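import Literature.NumberTheory.ConnesConsani.ScalingSiteH0Param
import Literature.Topology.DimensionTheory.EuclideanDimension
import HarnessLib

/-!
# Riemann–Roch of type II on the periodic orbit `C_p` (Connes–Consani 2017, Thm. 5.17): the proof

Topic `Literature/NumberTheory/ConnesConsani`, continuing `ScalingSitePeriodicOrbit.lean` (statement
layer, named fact `ConnesConsani2017_thm_5_17`), `ScalingSiteH0Levels.lean` (slopes, break points
based at `1`, `p`-adic size of slopes) and `ScalingSiteH0Param.lean` (the explicit parametrisation
`F_{t,y}` of `H⁰(D)^{pᵐ}`: MEMBERSHIP `ParamValid.toLevel` and REPRESENTATION `exists_paramValid`).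
Everything here is PROVED; the definitions are auxiliary (cells, the lower-bound family). The
main result is the discharge `ConnesConsani2017_thm_5_17_holds`.

## The printed proof (§5.4, arXiv:1603.03191 pp. 19–21) and the route taken here

Printed: Lemma 5.18 (i) (translation `ξ ↦ ξ - f`, `H⁰(D)^{pⁿ} ≅ H⁰(D + (f))^{pⁿ}` for
`‖f‖_p ≤ pⁿ`), (ii) (Frobenius `f ↦ pⁿ f`, `H⁰(D)^{pⁿ} ≅ H⁰(pⁿ D)^1`); Lemma 5.19 (the module
`ℰ_{N,p} = H⁰((H_p, N))^1` of convex piecewise affine functions on `[1,p]` with integral slopes,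
`f(1) = f(p)`, `-f'₊(1) + p f'₋(p) ≤ N`; the explicit `(N - p + 1)`-parameter family
`h(t₀, …, t_{N-p})`, continuous and injective from a compact cell, and the parameter count
`dim_top ℰ_{N,p} = N - p`); Thm. 5.17 by sandwiching `deg D` between `α₁ < deg D < α₂` in `H_p`
via Thm. 5.6 and letting `n → ∞`.

Here (same mechanism, arranged so that the finiteness of `dim_top` holds at EVERY level `pᵐ`, as
the tree's rendering of Thm. 5.17 (i) demands, and without the detour through Thm. 5.6): by
`ScalingSiteH0Param`, the restriction of `H⁰(D)^{pᵐ}` to `[1, p]` (the topology (46) only sees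
this restriction, `hasCoveringDimLE_level_iff`) is the union of the images `Ψ(Q_τ)` of finitely
many compact parameter cells `Q_τ ⊂ ℝ × ℝ^{F_τ}` (one for each combinatorial type `τ`: which
generators `(x - y_σ)₊` are pinned at `1`, `p` or a support point, which are free), on which
`Ψ : (t, w) ↦ p⁻ᵐ F_{t, fill w}` is continuous and injective (sorted free break points are
determined by the right slopes, Lemma 5.19 (iii)); the closure relation `F(p) = F(1)` and the order
condition at `1` bound the number of free generators of a nonempty admissible cell by
`F_τ ≤ pᵐ deg D` (the count of Lemma 5.19 (iv)), so `dim_top H⁰(D)^{pᵐ} ≤ ⌊pᵐ deg D⌋ + 1` for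
every `m` (cells have `dim ≤ F_τ + 1` as compact subsets of `ℝ^{F_τ+1}`; finite sum theorem over
the cells of a slab `{g(1) ∈ [j, j+1]}`, then over the slabs by parity — sum theorems from
`Literature/Topology/DimensionTheory`). Conversely an explicit type with `L = ⌊W⌋ - p` free
generators, `pᵐ deg D - p·#supp ≤ W ≤ pᵐ deg D`, carries a continuous injective image of the
closed unit ball of `ℝ^L` inside the level set (the family `h(t₀, …)` of Lemma 5.19 (iii)), so
`dim_top H⁰(D)^{pᵐ} ≥ L` by Lebesgue–Brouwer (`not_hasCoveringDimLE_closedBall`). Hence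
`pᵐ deg D - C ≤ dim_top H⁰(D)^{pᵐ} ≤ pᵐ deg D + 1` and `Dim_ℝ H⁰(D) = deg D` for `deg D ≥ 0`;
for `deg D < 0`, `H⁰(D) = ∅` (Lemma 5.13 (i)); (ii) follows from (i) and `deg(-D) = -deg D`.

## References
* A. Connes, C. Consani, *Geometry of the scaling site*, Selecta Math. (N.S.) 23 (2017)
  1803–1850, §5.4, Thm. 5.17 with Lemmas 5.13, 5.18, 5.19 [ConnesConsani2017ScalingSite].
* W. Hurewicz, H. Wallman, *Dimension Theory* (1941), Thm. III 2 (sum theorem), Thm. IV 1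
  (Lebesgue–Brouwer) [HurewiczWallman1941].
-/

noncomputable section

open Set Filter Metric Topology

namespace Literature.NumberTheory.ConnesConsani

open Literature.Topology.DimensionTheory in
/-- The local rendering of the covering dimension (Def. 5.16) agrees with the general one of
`Literature/Topology/DimensionTheory` (same definition). [cite: ConnesConsani2017ScalingSite, Def. 5.16] -/
theorem hasCoveringDimLE_iff_general (X : Type*) [TopologicalSpace X] (n : ℕ) :
    HasCoveringDimLE X n ↔ Literature.Topology.DimensionTheory.HasCoveringDimLE X n := Iff.rfl

/-- Same for `coveringDim`. [cite: ConnesConsani2017ScalingSite, Def. 5.16] -/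
theorem coveringDim_eq_general (X : Type*) [TopologicalSpace X] :
    coveringDim X = Literature.Topology.DimensionTheory.coveringDim X := rfl

/-! ### The model of `H⁰(D)^ρ` in `C([1, p], ℝ)` (topology of uniform convergence, eq. (46)) -/

section Model

variable {p : ℕ} [hp : Fact p.Prime]

/-- Restriction to `[1, p]`: the map `H⁰(D)^ρ → C([1,p], ℝ)` defining the topology (46).
[cite: ConnesConsani2017ScalingSite, §5.4 eq. (46)] -/
def levelRestrict (D : CpDivisor p) (ρ : ℝ) (f : CpH0Level D ρ) : C(Icc (1 : ℝ) p, ℝ) where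
  toFun x := f.1 x
  continuous_toFun :=
    (f.2.1.1.continuousOn_Ioi hp.out.one_lt).comp_continuous continuous_subtype_val
      fun x => lt_of_lt_of_le one_pos x.2.1

/-- Evaluation of the restriction. [cite: ConnesConsani2017ScalingSite, §5.4 eq. (46)] -/
@[simp] theorem levelRestrict_apply (D : CpDivisor p) (ρ : ℝ) (f : CpH0Level D ρ)
    (x : Icc (1 : ℝ) p) : levelRestrict D ρ f x = f.1 x := rfl

/-- The topology (46) on `H⁰(D)^ρ` is induced by the restriction to `[1, p]` (the space is not
`T₀`: functions may differ off `(0, ∞)`; the dimension only sees the image).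
[cite: ConnesConsani2017ScalingSite, §5.4 eq. (46)] -/
theorem isInducing_levelRestrict (D : CpDivisor p) (ρ : ℝ) : IsInducing (levelRestrict D ρ) := by
  have hι : IsInducing (fun g : C(Icc (1 : ℝ) p, ℝ) => UniformFun.ofFun (⇑g)) :=
    ContinuousMap.isUniformEmbedding_uniformFunOfFun.isInducing
  have h1 : IsInducing ((fun g : C(Icc (1 : ℝ) p, ℝ) => UniformFun.ofFun (⇑g)) ∘
      levelRestrict D ρ) := ⟨rfl⟩
  exact hι.of_comp_iff.mp h1

open Literature.Topology.DimensionTheory in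
/-- Dimension of `H⁰(D)^ρ` = dimension of its image in `C([1,p], ℝ)`.
[cite: ConnesConsani2017ScalingSite, §5.4 eq. (46) and Def. 5.16] -/
theorem hasCoveringDimLE_level_iff (D : CpDivisor p) (ρ : ℝ) (n : ℕ) :
    HasCoveringDimLE (CpH0Level D ρ) n ↔
      Literature.Topology.DimensionTheory.HasCoveringDimLE (range (levelRestrict D ρ)) n :=
  (isInducing_levelRestrict D ρ).hasCoveringDimLE_iff

end Model

/-! ### The parameter-to-function map `Ψ : (t, y) ↦ p^{-m} F_{t,y}|_{[1,p]}` and its injectivity -/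

section Cells

variable {p : ℕ} [hp : Fact p.Prime]

omit hp in
/-- Joint continuity of `(t, y, x) ↦ F_{t,y}(x)`. [cite: ConnesConsani2017ScalingSite, Lemma 5.19 (iii) ("The map … is continuous")] -/
theorem continuous_paramFun_uncurry (D : CpDivisor p) (m A M : ℕ) :
    Continuous (fun z : (ℝ × (Fin M → ℝ)) × ℝ => paramFun D m A z.1.1 z.1.2 z.2) := by
  unfold paramFun hinge
  refine ((?_ : Continuous _).add ?_).sub ?_
  · exact (continuous_fst.comp continuous_fst).sub
      (continuous_const.mul (continuous_snd.sub continuous_const))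
  · refine continuous_finsetSum _ fun σ _ => ?_
    exact (continuous_snd.sub ((continuous_apply σ).comp (continuous_snd.comp continuous_fst))).max
      continuous_const
  · refine continuous_finsetSum _ fun μ _ => continuous_const.mul ?_
    exact (continuous_snd.sub continuous_const).max continuous_const

/-- **The map `Ψ`** from parameters to `C([1,p], ℝ)`: `(t, y) ↦ (x ↦ p^{-m} F_{t,y}(x))`.
[cite: ConnesConsani2017ScalingSite, Lemma 5.19 (iii) (the map `h`)] -/
def paramMap (D : CpDivisor p) (m A M : ℕ) (q : ℝ × (Fin M → ℝ)) : C(Icc (1 : ℝ) p, ℝ) where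
  toFun x := ((p : ℝ) ^ m)⁻¹ * paramFun D m A q.1 q.2 x
  continuous_toFun :=
    continuous_const.mul ((continuous_paramFun D m A q.1 q.2).comp continuous_subtype_val)

omit hp in
/-- Evaluation of `Ψ`. [cite: ConnesConsani2017ScalingSite, Lemma 5.19 (iii)] -/
@[simp] theorem paramMap_apply (D : CpDivisor p) (m A M : ℕ) (q : ℝ × (Fin M → ℝ))
    (x : Icc (1 : ℝ) p) : paramMap D m A M q x = ((p : ℝ) ^ m)⁻¹ * paramFun D m A q.1 q.2 x := rfl

omit hp in
/-- `Ψ` is continuous (into the topology of uniform convergence on `[1,p]`).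
[cite: ConnesConsani2017ScalingSite, Lemma 5.19 (iii) ("The map … is continuous")] -/
theorem continuous_paramMap (D : CpDivisor p) (m A M : ℕ) : Continuous (paramMap D m A M) := by
  apply ContinuousMap.continuous_of_continuous_uncurry
  exact continuous_const.mul ((continuous_paramFun_uncurry D m A M).comp
    (continuous_fst.prodMk (continuous_subtype_val.comp continuous_snd)))

/-- Equality under `Ψ` means equality of `F_{t,y}` on `[1,p]`. [cite: ConnesConsani2017ScalingSite, Lemma 5.19 (iii)] -/
theorem eqOn_of_paramMap_eq {D : CpDivisor p} {m A M : ℕ} {q q' : ℝ × (Fin M → ℝ)}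
    (h : paramMap D m A M q = paramMap D m A M q') {x : ℝ} (hx : x ∈ Icc (1 : ℝ) p) :
    paramFun D m A q.1 q.2 x = paramFun D m A q'.1 q'.2 x := by
  have hpm : ((p : ℝ) ^ m)⁻¹ ≠ 0 :=
    inv_ne_zero (pow_ne_zero _ (by exact_mod_cast hp.out.ne_zero))
  have := DFunLike.congr_fun h ⟨x, hx⟩
  simp only [paramMap_apply] at this
  exact mul_left_cancel₀ hpm this

omit hp in
/-- Equality of `F_{t,y}` on `[1, p]` forces equal slopes: `slopeAt y u = slopeAt y' u` for
`u ∈ [1, p)`. [cite: ConnesConsani2017ScalingSite, Lemma 5.19 (iii) (injectivity of `h`)] -/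
theorem slopeAt_eq_of_eqOn {D : CpDivisor p} {m A M : ℕ} {t t' : ℝ} {y y' : Fin M → ℝ}
    (h : ∀ x ∈ Icc (1 : ℝ) p, paramFun D m A t y x = paramFun D m A t' y' x) {u : ℝ}
    (hu1 : 1 ≤ u) (hu2 : u < p) : slopeAt D m A y u = slopeAt D m A y' u := by
  have h1 := hasDerivWithinAt_paramFun_Ioi D m A t y u
  have h2 := hasDerivWithinAt_paramFun_Ioi D m A t' y' u
  have h2' : HasDerivWithinAt (paramFun D m A t y) (slopeAt D m A y' u : ℝ) (Ioi u) u := by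
    refine h2.congr_of_eventuallyEq ?_ (h u ⟨hu1, hu2.le⟩)
    filter_upwards [Ioo_mem_nhdsGT hu2] with z hz using h z ⟨hu1.trans hz.1.le, hz.2.le⟩
  exact_mod_cast (uniqueDiffWithinAt_Ioi u).eq_deriv _ h1 h2'

omit hp in
/-- Hence equal counting functions `#{σ | y_σ ≤ u}`. [cite: ConnesConsani2017ScalingSite, Lemma 5.19 (iii)] -/
theorem card_le_eq_of_eqOn {D : CpDivisor p} {m A M : ℕ} {t t' : ℝ} {y y' : Fin M → ℝ}
    (h : ∀ x ∈ Icc (1 : ℝ) p, paramFun D m A t y x = paramFun D m A t' y' x) {u : ℝ}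
    (hu1 : 1 ≤ u) (hu2 : u < p) :
    (Finset.univ.filter fun σ => y σ ≤ u).card = (Finset.univ.filter fun σ => y' σ ≤ u).card := by
  have := slopeAt_eq_of_eqOn h hu1 hu2
  unfold slopeAt at this
  omega

/-! ### Combinatorial types: free coordinates `I` and pinned values `v` -/

/-- The special values `V = {1, p} ∪ supp D` at which generators may be pinned.
[cite: ConnesConsani2017ScalingSite, Lemma 5.19 (iii)] -/
def specVals (D : CpDivisor p) : Finset ℝ := insert 1 (insert (p : ℝ) (suppFinset D))

/-- Special values lie in `[1, p]`. [cite: ConnesConsani2017ScalingSite, Lemma 5.19 (iii)] -/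
theorem mem_Icc_of_mem_specVals {D : CpDivisor p} {x : ℝ} (hx : x ∈ specVals D) :
    x ∈ Icc (1 : ℝ) p := by
  have hp1 : (1 : ℝ) ≤ p := by exact_mod_cast hp.out.one_lt.le
  unfold specVals at hx
  rcases Finset.mem_insert.1 hx with rfl | hx
  · exact ⟨le_rfl, hp1⟩
  rcases Finset.mem_insert.1 hx with rfl | hx
  · exact ⟨hp1, le_rfl⟩
  · exact ⟨(suppFinset_bound x hx).1.le, (suppFinset_bound x hx).2.le⟩

/-- Filling the free coordinates `I` of a type with the sorted vector `w` and the pinned ones with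
their special values `v`. [cite: ConnesConsani2017ScalingSite, Lemma 5.19 (iii)] -/
def fill {M : ℕ} (I : Finset (Fin M)) (v : Fin M → ℝ) (w : I → ℝ) : Fin M → ℝ :=
  fun σ => if h : σ ∈ I then w ⟨σ, h⟩ else v σ

omit hp in
/-- A free coordinate of a filled vector. [cite: ConnesConsani2017ScalingSite, Lemma 5.19 (iii)] -/
theorem fill_of_mem {M : ℕ} {I : Finset (Fin M)} (v : Fin M → ℝ) (w : I → ℝ) (i : I) :
    fill I v w i = w i := by
  unfold fill; rw [dif_pos i.2]

omit hp in
/-- A pinned coordinate of a filled vector. [cite: ConnesConsani2017ScalingSite, Lemma 5.19 (iii)] -/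
theorem fill_of_not_mem {M : ℕ} {I : Finset (Fin M)} (v : Fin M → ℝ) (w : I → ℝ) {σ : Fin M}
    (h : σ ∉ I) : fill I v w σ = v σ := by
  unfold fill; rw [dif_neg h]

omit hp in
/-- The counting function of a filled vector splits into the free and the pinned part.
[cite: ConnesConsani2017ScalingSite, Lemma 5.19 (iii)] -/
theorem card_fill_le {M : ℕ} (I : Finset (Fin M)) (v : Fin M → ℝ) (w : I → ℝ) (u : ℝ) :
    (Finset.univ.filter fun σ => fill I v w σ ≤ u).card =
      (Finset.univ.filter fun i : I => w i ≤ u).card +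
        ∑ σ ∈ Iᶜ, if v σ ≤ u then 1 else 0 := by
  classical
  rw [Finset.card_filter, Finset.card_filter, ← Finset.sum_add_sum_compl I]
  congr 1
  · rw [← Finset.sum_coe_sort]
    refine Finset.sum_congr rfl fun i _ => ?_
    rw [fill_of_mem]
  · refine Finset.sum_congr rfl fun σ hσ => ?_
    rw [fill_of_not_mem v w (Finset.mem_compl.1 hσ)]

omit hp in
/-- **Sorted vectors are determined by their counting functions** on `[1, p)` (values in `[1,p]`).
[cite: ConnesConsani2017ScalingSite, Lemma 5.19 (iii) (injectivity of `h`)] -/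
theorem eq_of_card_le_eq {ι : Type*} [Fintype ι] [LinearOrder ι] {w w' : ι → ℝ}
    (hw : Monotone w) (hw' : Monotone w') (h1 : ∀ i, 1 ≤ w i) (h1' : ∀ i, 1 ≤ w' i)
    (hp' : ∀ i, w i ≤ (p : ℝ)) (hpp : ∀ i, w' i ≤ (p : ℝ))
    (h : ∀ u : ℝ, 1 ≤ u → u < p →
      (Finset.univ.filter fun i => w i ≤ u).card = (Finset.univ.filter fun i => w' i ≤ u).card) :
    w = w' := by
  classical
  -- one-sided version
  have key : ∀ {a b : ι → ℝ}, Monotone a → Monotone b → (∀ i, 1 ≤ a i) → (∀ i, b i ≤ (p : ℝ)) →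
      (∀ u : ℝ, 1 ≤ u → u < p → (Finset.univ.filter fun i => a i ≤ u).card =
        (Finset.univ.filter fun i => b i ≤ u).card) → ∀ i, ¬ a i < b i := by
    intro a b ha hb ha1 hbp hab i hlt
    have hu := hab (a i) (ha1 i) (hlt.trans_le (hbp i))
    have hsub : (Finset.univ.filter fun j => b j ≤ a i) ⊆ Finset.univ.filter fun j => j < i := by
      intro j
      simp only [Finset.mem_filter, Finset.mem_univ, true_and]
      exact fun hj => hb.reflect_lt (hj.trans_lt hlt)
    have hsup : (Finset.univ.filter fun j => j ≤ i) ⊆ Finset.univ.filter fun j => a j ≤ a i := by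
      intro j
      simp only [Finset.mem_filter, Finset.mem_univ, true_and]
      exact fun hj => ha hj
    have hss : (Finset.univ.filter fun j : ι => j < i) ⊂ Finset.univ.filter fun j => j ≤ i := by
      rw [Finset.ssubset_iff_subset_ne]
      refine ⟨fun j => by
        simp only [Finset.mem_filter, Finset.mem_univ, true_and]; exact le_of_lt, fun heq => ?_⟩
      have : i ∈ Finset.univ.filter fun j : ι => j < i := by
        rw [heq]; simp
      simp at this
    have := Finset.card_lt_card hss
    have := Finset.card_le_card hsub
    have := Finset.card_le_card hsup
    omega
  funext i
  rcases lt_trichotomy (w i) (w' i) with hlt | heq | hgt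
  · exact absurd hlt (key hw hw' h1 hpp h i)
  · exact heq
  · exact absurd hgt (key hw' hw h1' hp' (fun u hu1 hu2 => (h u hu1 hu2).symm) i)

/-! ### Cells -/

/-- **Admissible types**: enough generators pinned at each support point, and the order condition
at `1` for the pinned counts at `1` and `p`. [cite: ConnesConsani2017ScalingSite, Lemma 5.19 (i)] -/
structure CellAdm (D : CpDivisor p) (m A : ℕ) {M : ℕ} (I : Finset (Fin M)) (v : Fin M → ℝ) :
    Prop where
  pinned : ∀ μ ∈ suppFinset D, (kinkWeight D m μ : ℝ) - (p : ℝ) ^ m * D.toFun μ / μ ≤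
    ((Finset.univ.filter fun σ => σ ∉ I ∧ v σ = μ).card : ℝ)
  ordOne : -((p : ℝ) ^ m * D.toFun 1) ≤
    (-(A : ℝ) + (Finset.univ.filter fun σ => σ ∉ I ∧ v σ = 1).card) -
      p * (-(A : ℝ) + ((M : ℝ) - (Finset.univ.filter fun σ => σ ∉ I ∧ v σ = p).card) -
        totalKink D m)

/-- **The parameter cell** of a type over the `t`-range `[a, b]`: sorted free coordinates in
`[1, p]` and the closure relation `F(p) = F(1)`. [cite: ConnesConsani2017ScalingSite, Lemma 5.19 (iii)–(iv)] -/
def cellSet (D : CpDivisor p) (m A : ℕ) {M : ℕ} (I : Finset (Fin M)) (v : Fin M → ℝ) (a b : ℝ) :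
    Set (ℝ × (I → ℝ)) :=
  {q | q.1 ∈ Icc a b ∧ (∀ i, q.2 i ∈ Icc (1 : ℝ) p) ∧ Monotone q.2 ∧
    paramFun D m A q.1 (fill I v q.2) p = paramFun D m A q.1 (fill I v q.2) 1}

/-- The cell map `Φ = Ψ ∘ θ`. [cite: ConnesConsani2017ScalingSite, Lemma 5.19 (iii)] -/
def cellMap (D : CpDivisor p) (m A : ℕ) {M : ℕ} (I : Finset (Fin M)) (v : Fin M → ℝ)
    (q : ℝ × (I → ℝ)) : C(Icc (1 : ℝ) p, ℝ) :=
  paramMap D m A M (q.1, fill I v q.2)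

omit hp in
/-- `θ : (t, w) ↦ (t, fill w)` is continuous. [cite: ConnesConsani2017ScalingSite, Lemma 5.19 (iii)] -/
theorem continuous_fill {M : ℕ} (I : Finset (Fin M)) (v : Fin M → ℝ) :
    Continuous (fun w : I → ℝ => fill I v w) := by
  refine continuous_pi fun σ => ?_
  by_cases h : σ ∈ I
  · simp only [fill, dif_pos h]; exact continuous_apply _
  · simp only [fill, dif_neg h]; exact continuous_const

omit hp in
/-- The cell map is continuous. [cite: ConnesConsani2017ScalingSite, Lemma 5.19 (iii)] -/
theorem continuous_cellMap (D : CpDivisor p) (m A : ℕ) {M : ℕ} (I : Finset (Fin M))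
    (v : Fin M → ℝ) : Continuous (cellMap D m A I v) :=
  (continuous_paramMap D m A M).comp
    (continuous_fst.prodMk ((continuous_fill I v).comp continuous_snd))

omit hp in
/-- The cell is compact. [cite: ConnesConsani2017ScalingSite, Lemma 5.19 (iv) ("`h` is a closed map")] -/
theorem isCompact_cellSet (D : CpDivisor p) (m A : ℕ) {M : ℕ} (I : Finset (Fin M))
    (v : Fin M → ℝ) (a b : ℝ) : IsCompact (cellSet D m A I v a b) := by
  have hbox : IsCompact ((Icc a b) ×ˢ (Set.univ.pi fun _ : I => Icc (1 : ℝ) p)) :=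
    isCompact_Icc.prod (isCompact_univ_pi fun _ => isCompact_Icc)
  refine hbox.of_isClosed_subset ?_ ?_
  · have h1 : IsClosed {q : ℝ × (I → ℝ) | q.1 ∈ Icc a b} := isClosed_Icc.preimage continuous_fst
    have h2 : IsClosed {q : ℝ × (I → ℝ) | ∀ i, q.2 i ∈ Icc (1 : ℝ) p} := by
      rw [setOf_forall]
      exact isClosed_iInter fun i =>
        isClosed_Icc.preimage ((continuous_apply i).comp continuous_snd)
    have h3 : IsClosed {q : ℝ × (I → ℝ) | Monotone q.2} := by
      simp only [Monotone, setOf_forall]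
      exact isClosed_iInter fun i => isClosed_iInter fun j => isClosed_iInter fun _ =>
        isClosed_le ((continuous_apply i).comp continuous_snd)
          ((continuous_apply j).comp continuous_snd)
    have hc : ∀ x : ℝ,
        Continuous (fun q : ℝ × (I → ℝ) => paramFun D m A q.1 (fill I v q.2) x) := by
      intro x
      have hθ : Continuous (fun q : ℝ × (I → ℝ) => ((q.1, fill I v q.2), x)) :=
        (continuous_fst.prodMk ((continuous_fill I v).comp continuous_snd)).prodMk
          continuous_const
      exact (continuous_paramFun_uncurry D m A M).comp hθ
    have h4 : IsClosed {q : ℝ × (I → ℝ) |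
        paramFun D m A q.1 (fill I v q.2) p = paramFun D m A q.1 (fill I v q.2) 1} :=
      isClosed_eq (hc p) (hc 1)
    exact h1.and (h2.and (h3.and h4))
  · rintro q ⟨h1, h2, -, -⟩
    exact ⟨h1, fun i _ => h2 i⟩

omit hp in
/-- Pinned values are at least `1` and at most `p`; so is every filled vector of a cell.
[cite: ConnesConsani2017ScalingSite, Lemma 5.19 (iii)] -/
theorem fill_mem_Icc {M : ℕ} {I : Finset (Fin M)} {v : Fin M → ℝ}
    (hv : ∀ σ, v σ ∈ Icc (1 : ℝ) p) {w : I → ℝ} (hw : ∀ i, w i ∈ Icc (1 : ℝ) p) (σ : Fin M) :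
    fill I v w σ ∈ Icc (1 : ℝ) p := by
  by_cases h : σ ∈ I
  · rw [show fill I v w σ = w ⟨σ, h⟩ from dif_pos h]; exact hw _
  · rw [fill_of_not_mem v w h]; exact hv σ

/-- **Injectivity of the cell map** on a cell. [cite: ConnesConsani2017ScalingSite, Lemma 5.19 (iii) ("The map … is injective")] -/
theorem injOn_cellMap (D : CpDivisor p) (m A : ℕ) {M : ℕ} (I : Finset (Fin M)) {v : Fin M → ℝ}
    (hv : ∀ σ, v σ ∈ Icc (1 : ℝ) p) (a b : ℝ) : InjOn (cellMap D m A I v) (cellSet D m A I v a b) := by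
  rintro ⟨t, w⟩ ⟨-, hw, hmono, -⟩ ⟨t', w'⟩ ⟨-, hw', hmono', -⟩ heq
  have h : ∀ x ∈ Icc (1 : ℝ) p,
      paramFun D m A t (fill I v w) x = paramFun D m A t' (fill I v w') x :=
    fun x hx => eqOn_of_paramMap_eq heq hx
  have ht : t = t' := by
    have := h 1 ⟨le_rfl, by exact_mod_cast hp.out.one_lt.le⟩
    rwa [paramFun_one D m A t (fun σ => (fill_mem_Icc hv hw σ).1),
      paramFun_one D m A t' (fun σ => (fill_mem_Icc hv hw' σ).1)] at this
  have hww : w = w' := by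
    refine eq_of_card_le_eq hmono hmono' (fun i => (hw i).1) (fun i => (hw' i).1)
      (fun i => (hw i).2) (fun i => (hw' i).2) fun u hu1 hu2 => ?_
    have hc := card_le_eq_of_eqOn h hu1 hu2
    rw [card_fill_le, card_fill_le] at hc
    omega
  rw [ht, hww]

end Cells

/-! ### Cells cover the slabs of the level set; the dimension count -/

section Count

open Literature.Topology.DimensionTheory hiding HasCoveringDimLE coveringDim

variable {p : ℕ} [hp : Fact p.Prime]

/-- The point `1 ∈ [1, p]`. [cite: ConnesConsani2017ScalingSite, §5.4 eq. (46)] -/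
def onePt : Icc (1 : ℝ) p := ⟨1, le_rfl, by exact_mod_cast hp.out.one_lt.le⟩

/-- The image `S` of `H⁰(D)^{p^m}` in `C([1,p], ℝ)`. [cite: ConnesConsani2017ScalingSite, §5.4 eq. (46)] -/
def levelSet (D : CpDivisor p) (m : ℕ) : Set C(Icc (1 : ℝ) p, ℝ) :=
  range (levelRestrict D ((p : ℝ) ^ m))

/-- The slab `S_j = {g ∈ S | g(1) ∈ [j, j+1]}`. [cite: ConnesConsani2017ScalingSite, Lemma 5.19 (iv)] -/
def slab (D : CpDivisor p) (m : ℕ) (j : ℤ) : Set C(Icc (1 : ℝ) p, ℝ) :=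
  {g | g ∈ levelSet D m ∧ g onePt ∈ Icc (j : ℝ) (j + 1)}

/-- Combinatorial types at level `p^m`: free index set and pinned special values.
[cite: ConnesConsani2017ScalingSite, Lemma 5.19 (iii)] -/
abbrev CellType (D : CpDivisor p) (m : ℕ) : Type :=
  Finset (Fin (bigM D m)) × (Fin (bigM D m) → specVals D)

/-- The pinned values of a type as real numbers. [cite: ConnesConsani2017ScalingSite, Lemma 5.19 (iii)] -/
def CellType.vals {D : CpDivisor p} {m : ℕ} (τ : CellType D m) : Fin (bigM D m) → ℝ :=
  fun σ => (τ.2 σ : ℝ)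

omit hp in
/-- Pinned values are special values. [cite: ConnesConsani2017ScalingSite, Lemma 5.19 (iii)] -/
theorem CellType.vals_mem {D : CpDivisor p} {m : ℕ} (τ : CellType D m) (σ : Fin (bigM D m)) :
    τ.vals σ ∈ specVals D := (τ.2 σ).2

open Classical in
/-- **The cell of a type in the slab `j`**: image of the compact parameter cell, or empty if the
type is not admissible. [cite: ConnesConsani2017ScalingSite, Lemma 5.19 (iii)–(iv)] -/
def cellImg (D : CpDivisor p) (m : ℕ) (j : ℤ) (τ : CellType D m) : Set C(Icc (1 : ℝ) p, ℝ) :=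
  if CellAdm D m (bigA D m) τ.1 τ.vals then
    cellMap D m (bigA D m) τ.1 τ.vals ''
      cellSet D m (bigA D m) τ.1 τ.vals ((p : ℝ) ^ m * j) ((p : ℝ) ^ m * (j + 1))
  else ∅

/-! #### Points of admissible cells are admissible parameters -/

section CellPoints

variable {D : CpDivisor p} {m A M : ℕ} {I : Finset (Fin M)} {v : Fin M → ℝ}

omit hp in
/-- Sums over the pinned coordinates, grouped by special value.
[cite: ConnesConsani2017ScalingSite, Lemma 5.19 (iv) (the count)] -/
theorem sum_compl_eq_sum_specVals (hvV : ∀ σ, v σ ∈ specVals D) (g : ℝ → ℝ) :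
    ∑ σ ∈ Iᶜ, g (v σ) =
      ∑ x ∈ specVals D, ((Finset.univ.filter fun σ => σ ∉ I ∧ v σ = x).card : ℝ) * g x := by
  classical
  have hP : ∀ x, (Finset.univ.filter fun σ => σ ∉ I ∧ v σ = x) = Iᶜ.filter (fun σ => v σ = x) := by
    intro x; ext σ; simp [Finset.mem_compl]
  simp_rw [hP, Finset.card_filter, Nat.cast_sum, Finset.sum_mul]
  rw [Finset.sum_comm]
  refine Finset.sum_congr rfl fun σ _ => ?_
  simp_rw [Nat.cast_ite, Nat.cast_one, Nat.cast_zero, ite_mul, one_mul, zero_mul]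
  rw [Finset.sum_ite_eq (specVals D) (v σ) g, if_pos (hvV σ)]

/-- A sum over the special values splits as `1`, `p`, support.
[cite: ConnesConsani2017ScalingSite, Lemma 5.19 (iv)] -/
theorem sum_specVals (D : CpDivisor p) (g : ℝ → ℝ) :
    ∑ x ∈ specVals D, g x = g 1 + g p + ∑ μ ∈ suppFinset D, g μ := by
  have hp1 : (1 : ℝ) < p := by exact_mod_cast hp.out.one_lt
  unfold specVals
  rw [Finset.sum_insert, Finset.sum_insert, add_assoc]
  · exact fun h => (mem_suppFinset.1 h).2.1.false
  · intro h
    rcases Finset.mem_insert.1 h with h | h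
    · exact hp1.ne h
    · exact (mem_suppFinset.1 h).1.false

/-- Points of an admissible cell are admissible parameters.
[cite: ConnesConsani2017ScalingSite, Lemma 5.19 (i), (iii)] -/
theorem paramValid_of_mem_cellSet (hvV : ∀ σ, v σ ∈ specVals D) (hadm : CellAdm D m A I v)
    {a b : ℝ} {q : ℝ × (I → ℝ)} (hq : q ∈ cellSet D m A I v a b) :
    ParamValid D m A q.1 (fill I v q.2) := by
  classical
  have hv : ∀ σ, v σ ∈ Icc (1 : ℝ) p := fun σ => mem_Icc_of_mem_specVals (hvV σ)
  obtain ⟨-, hw, -, hclos⟩ := hq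
  have hy := fill_mem_Icc hv hw
  refine ⟨fun σ => (hy σ).1, fun σ => (hy σ).2, fun μ hμ => (hadm.pinned μ hμ).trans ?_, hclos, ?_⟩
  · -- pinned
    exact_mod_cast Finset.card_le_card fun σ => by
      simp only [Finset.mem_filter, Finset.mem_univ, true_and]
      rintro ⟨h1, h2⟩
      rw [fill_of_not_mem v _ h1, h2]
  · -- ordOne: monotone in the counts
    refine hadm.ordOne.trans ?_
    have h1 : ((Finset.univ.filter fun σ => σ ∉ I ∧ v σ = 1).card : ℝ) ≤
        (Finset.univ.filter fun σ => fill I v q.2 σ = 1).card := by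
      exact_mod_cast Finset.card_le_card fun σ => by
        simp only [Finset.mem_filter, Finset.mem_univ, true_and]
        rintro ⟨h1, h2⟩
        rw [fill_of_not_mem v _ h1, h2]
    have h2 : ((Finset.univ.filter fun σ => fill I v q.2 σ < p).card : ℝ) ≤
        (M : ℝ) - (Finset.univ.filter fun σ => σ ∉ I ∧ v σ = p).card := by
      have hdisj : Disjoint (Finset.univ.filter fun σ => fill I v q.2 σ < p)
          (Finset.univ.filter fun σ => σ ∉ I ∧ v σ = p) := by
        rw [Finset.disjoint_filter]
        rintro σ - hlt ⟨h1, h2⟩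
        rw [fill_of_not_mem v _ h1, h2] at hlt
        exact lt_irrefl _ hlt
      have := Finset.card_le_univ ((Finset.univ.filter fun σ => fill I v q.2 σ < p) ∪
        Finset.univ.filter fun σ => σ ∉ I ∧ v σ = p)
      rw [Finset.card_union_of_disjoint hdisj, Fintype.card_fin] at this
      have : ((Finset.univ.filter fun σ => fill I v q.2 σ < p).card : ℝ) +
          (Finset.univ.filter fun σ => σ ∉ I ∧ v σ = p).card ≤ M := by exact_mod_cast this
      linarith
    have hpR : (0 : ℝ) ≤ p := by positivity
    nlinarith

/-- The restriction of the element with admissible parameters `(t, y)` is `Ψ(t, y)`.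
[cite: ConnesConsani2017ScalingSite, Lemma 5.19 (i), (iii)] -/
theorem levelRestrict_toLevel {D : CpDivisor p} {m A M : ℕ} {t : ℝ} {y : Fin M → ℝ}
    (hv : ParamValid D m A t y) :
    levelRestrict D ((p : ℝ) ^ m) hv.toLevel = paramMap D m A M (t, y) := by
  have hp1 := hp.out.one_lt
  ext x
  simp only [levelRestrict_apply, ParamValid.toLevel, paramElem, paramMap_apply]
  rcases x.2.2.eq_or_lt with hx | hx
  · rw [hx, fundRed_one_p hp1, hv.clos]
  · rw [fundRed_of_mem hp1 one_pos x.2.1 (by rw [mul_one]; exact hx)]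

/-- The cell maps into the slab (MEMBERSHIP for cells). [cite: ConnesConsani2017ScalingSite, Lemma 5.19 (i), (iii)] -/
theorem cellMap_mem_slab {D : CpDivisor p} {m : ℕ} {I : Finset (Fin (bigM D m))}
    {v : Fin (bigM D m) → ℝ} (hvV : ∀ σ, v σ ∈ specVals D) (hadm : CellAdm D m (bigA D m) I v)
    {j : ℤ} {q : ℝ × (I → ℝ)}
    (hq : q ∈ cellSet D m (bigA D m) I v ((p : ℝ) ^ m * j) ((p : ℝ) ^ m * (j + 1))) :
    cellMap D m (bigA D m) I v q ∈ slab D m j := by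
  have hp1 := hp.out.one_lt
  have hpm : (0 : ℝ) < (p : ℝ) ^ m := pow_pos (by exact_mod_cast hp.out.pos) m
  have hval := paramValid_of_mem_cellSet hvV hadm hq
  refine ⟨⟨hval.toLevel, levelRestrict_toLevel hval⟩, ?_⟩
  · simp only [cellMap, paramMap_apply]
    rw [show ((onePt : Icc (1 : ℝ) p) : ℝ) = 1 from rfl, paramFun_one D m _ _ hval.one_le]
    obtain ⟨⟨h1, h2⟩, -, -, -⟩ := hq
    constructor
    · rw [le_inv_mul_iff₀ hpm]; exact h1
    · rw [inv_mul_le_iff₀ hpm]; exact h2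

/-- **The dimension count**: an admissible type with a nonempty cell has at most `p^m deg D`
free coordinates. [cite: ConnesConsani2017ScalingSite, Lemma 5.19 (iv) ("topological dimension … `N - p`")] -/
theorem card_le_of_mem_cellSet (hvV : ∀ σ, v σ ∈ specVals D) (hadm : CellAdm D m A I v)
    {a b : ℝ} {q : ℝ × (I → ℝ)} (hq : q ∈ cellSet D m A I v a b) :
    (I.card : ℝ) ≤ (p : ℝ) ^ m * (D.toFun 1 + ∑ μ ∈ suppFinset D, D.toFun μ) := by
  classical
  have hp1 : (1 : ℝ) ≤ p := by exact_mod_cast hp.out.one_lt.le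
  have hv : ∀ σ, v σ ∈ Icc (1 : ℝ) p := fun σ => mem_Icc_of_mem_specVals (hvV σ)
  obtain ⟨-, hw, -, hclos⟩ := hq
  have hy := fill_mem_Icc hv hw
  set y := fill I v q.2 with hydef
  set cnt : ℝ → ℝ := fun x => ((Finset.univ.filter fun σ => σ ∉ I ∧ v σ = x).card : ℝ) with hcnt
  -- (1) the partition count `M - F = a + b + N`
  have e1 : ((M : ℝ) - I.card) = cnt 1 + cnt p + ∑ μ ∈ suppFinset D, cnt μ := by
    have h := sum_compl_eq_sum_specVals (I := I) hvV (fun _ => (1 : ℝ))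
    rw [sum_specVals] at h
    simp only [mul_one, Finset.sum_const, nsmul_eq_mul, Finset.card_compl,
      Fintype.card_fin] at h
    rw [Nat.cast_sub (I.card_le_univ.trans_eq (Fintype.card_fin M))] at h
    exact h
  have e1p : (p : ℝ) * ((M : ℝ) - I.card) = p * (cnt 1 + cnt p + ∑ μ ∈ suppFinset D, cnt μ) := by
    rw [e1]
  -- (2) the closure relation expanded
  have e2 : (A : ℝ) * (p - 1) + ∑ μ ∈ suppFinset D, (kinkWeight D m μ : ℝ) * (p - μ) =
      (∑ i : I, ((p : ℝ) - q.2 i)) + cnt 1 * (p - 1) +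
        ∑ μ ∈ suppFinset D, cnt μ * (p - μ) := by
    have hc : paramFun D m A q.1 y p = paramFun D m A q.1 y 1 := hclos
    rw [paramFun_one D m A _ (fun σ => (hy σ).1)] at hc
    unfold paramFun at hc
    rw [Finset.sum_congr rfl fun σ _ => hinge_of_le (hy σ).2,
      Finset.sum_congr rfl fun μ (hμ : μ ∈ suppFinset D) =>
        show (kinkWeight D m μ : ℝ) * hinge μ p = kinkWeight D m μ * (p - μ) by
          rw [hinge_of_le (mem_suppFinset.1 hμ).2.1.le],
      ← Finset.sum_add_sum_compl I] at hc
    have hI : ∑ σ ∈ I, ((p : ℝ) - y σ) = ∑ i : I, ((p : ℝ) - q.2 i) := by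
      rw [← Finset.sum_coe_sort]
      exact Finset.sum_congr rfl fun i _ => by rw [hydef, fill_of_mem]
    have hIc : ∑ σ ∈ Iᶜ, ((p : ℝ) - y σ) = cnt 1 * (p - 1) + ∑ μ ∈ suppFinset D, cnt μ * (p - μ) := by
      rw [show ∑ σ ∈ Iᶜ, ((p : ℝ) - y σ) = ∑ σ ∈ Iᶜ, ((p : ℝ) - v σ) from
        Finset.sum_congr rfl fun σ hσ => by rw [hydef, fill_of_not_mem v _ (Finset.mem_compl.1 hσ)],
        sum_compl_eq_sum_specVals hvV (fun x => (p : ℝ) - x), sum_specVals]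
      ring
    rw [hI, hIc] at hc
    linarith
  -- (3) the free part is at most `F (p - 1)`
  have e3 : (∑ i : I, ((p : ℝ) - q.2 i)) ≤ I.card * (p - 1) := by
    have := Finset.sum_le_sum fun (i : I) (_ : i ∈ Finset.univ) =>
      show (p : ℝ) - q.2 i ≤ p - 1 by linarith [(hw i).1]
    rw [Finset.sum_const, Finset.card_univ, Fintype.card_coe, nsmul_eq_mul] at this
    exact this
  -- (4) the order condition at `1`
  have e4 := hadm.ordOne
  -- (5) pinned: `(k_μ - n_μ) μ ≤ p^m D(μ)`
  have e5 : ∑ μ ∈ suppFinset D, ((kinkWeight D m μ : ℝ) - cnt μ) * μ ≤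
      ∑ μ ∈ suppFinset D, (p : ℝ) ^ m * D.toFun μ := by
    refine Finset.sum_le_sum fun μ hμ => ?_
    have hμ0 : 0 < μ := one_pos.trans (mem_suppFinset.1 hμ).1
    have := hadm.pinned μ hμ
    have := mul_le_mul_of_nonneg_right this hμ0.le
    rw [sub_mul, div_mul_cancel₀ _ hμ0.ne'] at this
    linarith
  -- expand the sums and conclude by linear arithmetic
  have eK : ∑ μ ∈ suppFinset D, (kinkWeight D m μ : ℝ) * (p - μ) =
      p * totalKink D m - ∑ μ ∈ suppFinset D, (kinkWeight D m μ : ℝ) * μ := by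
    unfold totalKink; push_cast
    rw [Finset.mul_sum, ← Finset.sum_sub_distrib]
    exact Finset.sum_congr rfl fun _ _ => by ring
  have eN : ∑ μ ∈ suppFinset D, cnt μ * (p - μ) =
      p * ∑ μ ∈ suppFinset D, cnt μ - ∑ μ ∈ suppFinset D, cnt μ * μ := by
    rw [Finset.mul_sum, ← Finset.sum_sub_distrib]
    exact Finset.sum_congr rfl fun _ _ => by ring
  have eS : ∑ μ ∈ suppFinset D, ((kinkWeight D m μ : ℝ) - cnt μ) * μ =
      ∑ μ ∈ suppFinset D, (kinkWeight D m μ : ℝ) * μ - ∑ μ ∈ suppFinset D, cnt μ * μ := by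
    rw [← Finset.sum_sub_distrib]
    exact Finset.sum_congr rfl fun _ _ => by ring
  rw [← Finset.mul_sum] at e5
  rw [mul_add]
  linarith

end CellPoints

/-! #### The slab is covered by the cells (via the exact type of a representation) -/

omit hp in
/-- `1 ∈ V`. [cite: ConnesConsani2017ScalingSite, Lemma 5.19 (iii)] -/
theorem one_mem_specVals (D : CpDivisor p) : (1 : ℝ) ∈ specVals D := Finset.mem_insert_self _ _

/-- **Cover**: every element of the slab lies in the cell of its exact type.
[cite: ConnesConsani2017ScalingSite, Lemma 5.19 (iii)–(iv)] -/
theorem exists_mem_cellImg {D : CpDivisor p} {m : ℕ} {j : ℤ} {g : C(Icc (1 : ℝ) p, ℝ)}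
    (hg : g ∈ slab D m j) : ∃ τ : CellType D m, g ∈ cellImg D m j τ := by
  classical
  have hp1 := hp.out.one_lt
  have hpR : (1 : ℝ) ≤ p := by exact_mod_cast hp1.le
  have hpm : (0 : ℝ) < (p : ℝ) ^ m := pow_pos (by exact_mod_cast hp.out.pos) m
  obtain ⟨⟨F, rfl⟩, hg1⟩ := hg
  obtain ⟨y, hmono, hval, heq⟩ := exists_paramValid F
  set t := (p : ℝ) ^ m * F.1 1 with ht
  -- the exact type
  set I : Finset (Fin (bigM D m)) := Finset.univ.filter fun σ => y σ ∉ specVals D with hI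
  set vv : Fin (bigM D m) → specVals D := fun σ =>
    if h : y σ ∈ specVals D then ⟨y σ, h⟩ else ⟨1, one_mem_specVals D⟩ with hvv
  let τ : CellType D m := (I, vv)
  have hv : ∀ σ, σ ∉ I → τ.vals σ = y σ := by
    intro σ hσ
    have : y σ ∈ specVals D := by simpa [hI] using hσ
    simp [CellType.vals, τ, hvv, this]
  set w : I → ℝ := fun i => y i with hw
  have hfill : fill I τ.vals w = y := by
    funext σ
    by_cases hσ : σ ∈ I
    · exact dif_pos hσ
    · rw [fill_of_not_mem _ _ hσ, hv σ hσ]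
  have hcnt : ∀ x ∈ specVals D, (Finset.univ.filter fun σ => σ ∉ I ∧ τ.vals σ = x) =
      Finset.univ.filter fun σ => y σ = x := by
    intro x hx
    ext σ
    simp only [Finset.mem_filter, Finset.mem_univ, true_and]
    constructor
    · rintro ⟨h1, h2⟩; rw [← hv σ h1, h2]
    · intro h
      have hσ : σ ∉ I := by simp [hI, h, hx]
      exact ⟨hσ, by rw [hv σ hσ, h]⟩
  have hpmem : (p : ℝ) ∈ specVals D := by simp [specVals]
  have hadm : CellAdm D m (bigA D m) I τ.vals := by
    refine ⟨fun μ hμ => ?_, ?_⟩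
    · rw [hcnt μ (by simp [specVals, hμ])]; exact hval.pinned μ hμ
    · rw [hcnt 1 (one_mem_specVals D), hcnt p hpmem]
      have hlt : ((Finset.univ.filter fun σ => y σ < p).card : ℝ) =
          (bigM D m : ℝ) - (Finset.univ.filter fun σ => y σ = p).card := by
        have h := Finset.card_filter_add_card_filter_not (s := Finset.univ)
          (fun σ : Fin (bigM D m) => y σ < p)
        rw [Finset.card_univ, Fintype.card_fin] at h
        have h' : (Finset.univ.filter fun σ : Fin (bigM D m) => ¬ y σ < p) =
            Finset.univ.filter fun σ => y σ = p := by
          ext σ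
          simp only [Finset.mem_filter, Finset.mem_univ, true_and, not_lt]
          exact ⟨fun h => le_antisymm (hval.le_p σ) h, fun h => h.ge⟩
        rw [h'] at h
        have : ((Finset.univ.filter fun σ => y σ < p).card : ℝ) +
            (Finset.univ.filter fun σ => y σ = p).card = bigM D m := by exact_mod_cast h
        linarith
      rw [← hlt]
      exact hval.ordOne
  refine ⟨τ, ?_⟩
  rw [cellImg, if_pos hadm]
  refine ⟨(t, w), ⟨?_, fun i => ⟨hval.one_le _, hval.le_p _⟩, fun i i' h => hmono h, ?_⟩, ?_⟩
  · obtain ⟨h1, h2⟩ := hg1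
    simp only [levelRestrict_apply] at h1 h2
    exact ⟨by rw [ht]; exact mul_le_mul_of_nonneg_left h1 hpm.le,
      by rw [ht]; exact mul_le_mul_of_nonneg_left h2 hpm.le⟩
  · show paramFun D m (bigA D m) t (fill I τ.vals w) p =
      paramFun D m (bigA D m) t (fill I τ.vals w) 1
    rw [hfill]; exact hval.clos
  · ext x
    simp only [cellMap, paramMap_apply, levelRestrict_apply]
    rw [hfill, ← heq x x.2, ← mul_assoc, inv_mul_cancel₀ hpm.ne', one_mul]

/-! #### Dimension of cells, slabs, and the level set -/

/-- The dimension bound `U_m = ⌊p^m deg D⌋ + 1`. [cite: ConnesConsani2017ScalingSite, Lemma 5.19 (iv)] -/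
def dimUB (D : CpDivisor p) (m : ℕ) : ℕ := ⌊(p : ℝ) ^ m * cpDeg D⌋₊ + 1

/-- `deg D = D(1) + Σ_{μ ∈ supp} D(μ)`. [cite: ConnesConsani2017ScalingSite, Prop. 5.4 (iii) (`deg(D) := Σ_H D(H)`)] -/
theorem cpDeg_eq_sum (D : CpDivisor p) :
    cpDeg D = D.toFun 1 + ∑ μ ∈ suppFinset D, D.toFun μ := by
  classical
  have hp1 : (1 : ℝ) < p := by exact_mod_cast hp.out.one_lt
  unfold cpDeg
  rw [finsum_mem_eq_sum_of_subset (t := insert 1 (suppFinset D)) _ ?_ ?_, Finset.sum_insert]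
  · exact fun h => (mem_suppFinset.1 h).1.false
  · rintro x ⟨⟨hx1, hx2⟩, hx3⟩
    rcases hx1.eq_or_lt with h | h
    · exact Finset.mem_coe.2 (Finset.mem_insert.2 (Or.inl h.symm))
    · exact Finset.mem_coe.2 (Finset.mem_insert.2 (Or.inr (mem_suppFinset.2 ⟨h, hx2, hx3⟩)))
  · intro x hx
    rcases Finset.mem_insert.1 (Finset.mem_coe.1 hx) with rfl | hx
    · exact ⟨le_rfl, hp1⟩
    · exact ⟨(mem_suppFinset.1 hx).1.le, (mem_suppFinset.1 hx).2.1⟩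

/-- **Dimension of a cell**: `≤ ⌊p^m deg D⌋ + 1`. [cite: ConnesConsani2017ScalingSite, Lemma 5.19 (iv)] -/
theorem hasCoveringDimLE_cellImg (D : CpDivisor p) (m : ℕ) (j : ℤ) (τ : CellType D m) :
    Literature.Topology.DimensionTheory.HasCoveringDimLE (cellImg D m j τ) (dimUB D m) := by
  classical
  by_cases hadm : CellAdm D m (bigA D m) τ.1 τ.vals
  · rw [cellImg, if_pos hadm]
    rcases (cellSet D m (bigA D m) τ.1 τ.vals ((p : ℝ) ^ m * j)
      ((p : ℝ) ^ m * (j + 1))).eq_empty_or_nonempty with hQe | ⟨q, hq⟩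
    · rw [hQe, image_empty]
      exact HasCoveringDimLE.of_subsingleton _
    · have hd : Module.finrank ℝ (ℝ × (τ.1 → ℝ)) = τ.1.card + 1 := by
        rw [Module.finrank_prod, Module.finrank_self, Module.finrank_fintype_fun_eq_card,
          Fintype.card_coe, add_comm]
      have h := hasCoveringDimLE_image_of_isCompact hd
        (isCompact_cellSet D m (bigA D m) τ.1 τ.vals ((p : ℝ) ^ m * j) ((p : ℝ) ^ m * (j + 1)))
        (continuous_cellMap D m (bigA D m) τ.1 τ.vals).continuousOn
        (injOn_cellMap D m (bigA D m) τ.1 (fun σ => mem_Icc_of_mem_specVals (τ.vals_mem σ))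
          ((p : ℝ) ^ m * j) ((p : ℝ) ^ m * (j + 1)))
      refine h.mono ?_
      have hc := card_le_of_mem_cellSet τ.vals_mem hadm hq
      rw [← cpDeg_eq_sum] at hc
      unfold dimUB
      have : τ.1.card ≤ ⌊(p : ℝ) ^ m * cpDeg D⌋₊ := Nat.le_floor hc
      omega
  · rw [cellImg, if_neg hadm]
    exact HasCoveringDimLE.of_subsingleton _

omit hp in
/-- Cells are closed. [cite: ConnesConsani2017ScalingSite, Lemma 5.19 (iv) ("`h` is a closed map")] -/
theorem isClosed_cellImg (D : CpDivisor p) (m : ℕ) (j : ℤ) (τ : CellType D m) :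
    IsClosed (cellImg D m j τ) := by
  by_cases hadm : CellAdm D m (bigA D m) τ.1 τ.vals
  · rw [cellImg, if_pos hadm]
    exact ((isCompact_cellSet D m _ τ.1 τ.vals _ _).image (continuous_cellMap D m _ τ.1 _)).isClosed
  · rw [cellImg, if_neg hadm]
    exact isClosed_empty

/-- Cells lie in the slab. [cite: ConnesConsani2017ScalingSite, Lemma 5.19 (iii)] -/
theorem cellImg_subset_slab (D : CpDivisor p) (m : ℕ) (j : ℤ) (τ : CellType D m) :
    cellImg D m j τ ⊆ slab D m j := by
  by_cases hadm : CellAdm D m (bigA D m) τ.1 τ.vals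
  · rw [cellImg, if_pos hadm]
    rintro _ ⟨q, hq, rfl⟩
    exact cellMap_mem_slab τ.vals_mem hadm hq
  · rw [cellImg, if_neg hadm]
    exact empty_subset _

/-- **Dimension of a slab** (finite sum theorem over the cells).
[cite: ConnesConsani2017ScalingSite, Lemma 5.19 (iv)] -/
theorem hasCoveringDimLE_slab (D : CpDivisor p) (m : ℕ) (j : ℤ) :
    Literature.Topology.DimensionTheory.HasCoveringDimLE (slab D m j) (dimUB D m) := by
  refine HasCoveringDimLE.of_finite_closed_cover (κ := CellType D m)
    (F := fun τ => Subtype.val ⁻¹' cellImg D m j τ) (fun τ => ?_) ?_ (fun τ => ?_)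
  · exact (isClosed_cellImg D m j τ).preimage continuous_subtype_val
  · ext g
    simp only [mem_iUnion, mem_preimage, mem_univ, iff_true]
    exact exists_mem_cellImg g.2
  · exact (hasCoveringDimLE_preimage_val_iff (cellImg_subset_slab D m j τ)).2
      (hasCoveringDimLE_cellImg D m j τ)

/-! #### Parity assembly over the slabs -/

/-- The union of the slabs of parity `c`. [cite: HurewiczWallman1941, Thm. III 2 (sum theorem), proof pattern] -/
def slabUnion (D : CpDivisor p) (m : ℕ) (c : ℤ) : Set C(Icc (1 : ℝ) p, ℝ) :=
  ⋃ k : ℤ, slab D m (2 * k + c)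

omit hp in
/-- `⋃_k [2k + c, 2k + c + 1]` is closed (locally finite union). [folklore] -/
private theorem isClosed_iUnion_Icc (c : ℝ) :
    IsClosed (⋃ k : ℤ, Icc (2 * (k : ℝ) + c) (2 * k + c + 1)) := by
  refine LocallyFinite.isClosed_iUnion (fun x => ?_) fun k => isClosed_Icc
  refine ⟨Ioo (x - 1) (x + 1), Ioo_mem_nhds (by linarith) (by linarith), ?_⟩
  refine (Set.finite_Icc ⌊(x - c - 2) / 2⌋ ⌈(x - c + 1) / 2⌉).subset ?_
  rintro k ⟨y, ⟨hy1, hy2⟩, hy3, hy4⟩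
  constructor
  · have : ((⌊(x - c - 2) / 2⌋ : ℤ) : ℝ) < k := by
      have := Int.floor_le ((x - c - 2) / 2); linarith
    exact_mod_cast this.le
  · have : (k : ℝ) < ⌈(x - c + 1) / 2⌉ := by
      have := Int.le_ceil ((x - c + 1) / 2); linarith
    exact_mod_cast this.le

/-- Evaluation at `1` is continuous on `C([1,p], ℝ)`. [cite: ConnesConsani2017ScalingSite, §5.4 eq. (46)] -/
theorem continuous_evalOne : Continuous fun g : C(Icc (1 : ℝ) p, ℝ) => g onePt :=
  continuous_eval_const _

/-- `slabUnion c` is the part of the level set with `g(1) ∈ ⋃_k [2k+c, 2k+c+1]`.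
[cite: HurewiczWallman1941, Thm. III 2, proof pattern] -/
theorem slabUnion_eq (D : CpDivisor p) (m : ℕ) (c : ℤ) :
    slabUnion D m c = levelSet D m ∩
      (fun g : C(Icc (1 : ℝ) p, ℝ) => g onePt) ⁻¹' ⋃ k : ℤ, Icc (2 * (k : ℝ) + c) (2 * k + c + 1) := by
  ext g
  simp only [slabUnion, slab, mem_iUnion, mem_inter_iff, mem_preimage, mem_setOf_eq]
  constructor
  · rintro ⟨k, h1, h2⟩; exact ⟨h1, k, by push_cast at h2; exact h2⟩
  · rintro ⟨h1, k, h2⟩; exact ⟨k, h1, by push_cast; exact h2⟩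

/-- **Dimension of a parity class of slabs** (disjoint open pieces).
[cite: HurewiczWallman1941, Thm. III 2, proof pattern] -/
theorem hasCoveringDimLE_slabUnion (D : CpDivisor p) (m : ℕ) (c : ℤ) :
    Literature.Topology.DimensionTheory.HasCoveringDimLE (slabUnion D m c) (dimUB D m) := by
  have hsub : ∀ k : ℤ, slab D m (2 * k + c) ⊆ slabUnion D m c :=
    fun k => subset_iUnion (fun k : ℤ => slab D m (2 * k + c)) k
  refine HasCoveringDimLE.of_pairwiseDisjoint_isOpen (ι := ℤ)
    (S := fun k => Subtype.val ⁻¹' slab D m (2 * k + c)) (fun k => ?_) ?_ ?_ (fun k => ?_)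
  · -- open: the trace of the open interval `(2k+c-1, 2k+c+2)`
    have : (Subtype.val ⁻¹' slab D m (2 * k + c) : Set (slabUnion D m c)) =
        (fun g : slabUnion D m c => (g : C(Icc (1 : ℝ) p, ℝ)) onePt) ⁻¹'
          Ioo (2 * (k : ℝ) + c - 1) (2 * k + c + 2) := by
      ext ⟨g, hg⟩
      simp only [mem_preimage, slab, mem_setOf_eq, mem_Ioo, mem_Icc]
      constructor
      · rintro ⟨-, h1, h2⟩; push_cast at h1 h2; exact ⟨by linarith, by linarith⟩
      · rintro ⟨h1, h2⟩
        obtain ⟨k', hk', h3, h4⟩ := mem_iUnion.1 hg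
        push_cast at h3 h4 ⊢
        have hk : k' = k := by
          have h5 : (k' : ℝ) < k + 1 := by linarith
          have h6 : (k : ℝ) < k' + 1 := by linarith
          have h5' : k' < k + 1 := by exact_mod_cast h5
          have h6' : k < k' + 1 := by exact_mod_cast h6
          omega
        subst hk
        exact ⟨hk', h3, h4⟩
    rw [this]
    exact isOpen_Ioo.preimage (continuous_evalOne.comp continuous_subtype_val)
  · -- pairwise disjoint
    intro k k' hkk
    rw [Function.onFun, Set.disjoint_left]
    rintro ⟨g, hg⟩ ⟨-, h1, h2⟩ ⟨-, h3, h4⟩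
    push_cast at h1 h2 h3 h4
    have h5 : (k : ℝ) < k' + 1 := by linarith
    have h6 : (k' : ℝ) < k + 1 := by linarith
    have h5' : k < k' + 1 := by exact_mod_cast h5
    have h6' : k' < k + 1 := by exact_mod_cast h6
    exact hkk (by omega)
  · ext ⟨g, hg⟩
    simp only [mem_iUnion, mem_preimage, mem_univ, iff_true]
    exact mem_iUnion.1 hg
  · exact (hasCoveringDimLE_preimage_val_iff (hsub k)).2 (hasCoveringDimLE_slab D m _)

/-- **Finiteness of the dimension at every level** (general form):
`dim_top H⁰(D)^{p^m} ≤ ⌊p^m deg D⌋ + 1`, in `C([1,p], ℝ)`. [cite: ConnesConsani2017ScalingSite, Thm. 5.17 (i) with Lemma 5.19 (iv)] -/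
theorem hasCoveringDimLE_levelSet (D : CpDivisor p) (m : ℕ) :
    Literature.Topology.DimensionTheory.HasCoveringDimLE (levelSet D m) (dimUB D m) := by
  have hsub : ∀ c : Fin 2, slabUnion D m (c : ℕ) ⊆ levelSet D m :=
    fun c => iUnion_subset fun k g hg => hg.1
  refine HasCoveringDimLE.of_finite_closed_cover (κ := Fin 2)
    (F := fun c => Subtype.val ⁻¹' slabUnion D m (c : ℕ)) (fun c => ?_) ?_ (fun c => ?_)
  · have : (Subtype.val ⁻¹' slabUnion D m (c : ℕ) : Set (levelSet D m)) =
        (fun g : levelSet D m => (g : C(Icc (1 : ℝ) p, ℝ)) onePt) ⁻¹'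
          ⋃ k : ℤ, Icc (2 * (k : ℝ) + ((c : ℕ) : ℤ)) (2 * k + ((c : ℕ) : ℤ) + 1) := by
      rw [slabUnion_eq]
      ext ⟨g, hg⟩
      simp only [mem_preimage, mem_inter_iff, and_iff_right_iff_imp]
      exact fun _ => hg
    rw [this]
    exact (isClosed_iUnion_Icc _).preimage (continuous_evalOne.comp continuous_subtype_val)
  · ext ⟨g, hg⟩
    simp only [mem_iUnion, mem_preimage, mem_univ, iff_true, Fin.exists_fin_two, Fin.val_zero,
      Fin.val_one, Nat.cast_zero, Nat.cast_one]
    set x := g onePt with hx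
    set k := ⌊x / 2⌋ with hk
    have h1 : (k : ℝ) ≤ x / 2 := Int.floor_le _
    have h2 : x / 2 < k + 1 := Int.lt_floor_add_one _
    by_cases hc : x ≤ 2 * k + 1
    · refine Or.inl (mem_iUnion.2 ⟨k, hg, ?_⟩)
      push_cast
      exact ⟨by linarith, by linarith⟩
    · refine Or.inr (mem_iUnion.2 ⟨k, hg, ?_⟩)
      push_cast
      push Not at hc
      exact ⟨by linarith, by linarith⟩
  · exact (hasCoveringDimLE_preimage_val_iff (hsub c)).2 (hasCoveringDimLE_slabUnion D m _)

end Count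

/-! ### The lower bound: an embedded ball of dimension `≈ p^m deg D` (Lemma 5.19 (iii)–(iv)) -/

section LowerBound

open Literature.Topology.DimensionTheory hiding HasCoveringDimLE coveringDim

variable {p : ℕ} [hp : Fact p.Prime]

/-! #### Bounds on the free-generator count `W` -/

section WBounds

variable (D : CpDivisor p) (m : ℕ)

omit hp in
/-- `(k_μ - n_μ) μ ≤ p^m D(μ)`. [cite: ConnesConsani2017ScalingSite, Lemma 5.18 (i)] -/
theorem kink_sub_pin_mul_le {μ : ℝ} (hμ : μ ∈ suppFinset D) :
    ((kinkWeight D m μ : ℝ) - pinCount D m μ) * μ ≤ (p : ℝ) ^ m * D.toFun μ := by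
  have hμ0 : 0 < μ := one_pos.trans (mem_suppFinset.1 hμ).1
  have h : (kinkWeight D m μ : ℝ) - (p : ℝ) ^ m * D.toFun μ / μ ≤ pinCount D m μ := Nat.le_ceil _
  have := mul_le_mul_of_nonneg_right h hμ0.le
  rw [sub_mul, div_mul_cancel₀ _ hμ0.ne'] at this
  linarith

omit hp in
/-- `p^m D(μ) - μ ≤ (k_μ - n_μ) μ`. [cite: ConnesConsani2017ScalingSite, Lemma 5.18 (i)] -/
theorem kink_sub_pin_mul_ge {μ : ℝ} (hμ : μ ∈ suppFinset D) :
    (p : ℝ) ^ m * D.toFun μ - μ ≤ ((kinkWeight D m μ : ℝ) - pinCount D m μ) * μ := by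
  have hμ0 : 0 < μ := one_pos.trans (mem_suppFinset.1 hμ).1
  have hk : (p : ℝ) ^ m * D.toFun μ / μ ≤ kinkWeight D m μ := Nat.le_ceil _
  have hn : (pinCount D m μ : ℝ) < (kinkWeight D m μ : ℝ) - (p : ℝ) ^ m * D.toFun μ / μ + 1 :=
    Nat.ceil_lt_add_one (by linarith)
  have : ((p : ℝ) ^ m * D.toFun μ / μ - 1) * μ ≤ ((kinkWeight D m μ : ℝ) - pinCount D m μ) * μ :=
    mul_le_mul_of_nonneg_right (by linarith) hμ0.le
  rw [sub_mul, div_mul_cancel₀ _ hμ0.ne', one_mul] at this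
  exact this

/-- `W ≤ p^m deg D`. [cite: ConnesConsani2017ScalingSite, Lemma 5.19 (iv)] -/
theorem freeBound_le : freeBound D m ≤ (p : ℝ) ^ m * cpDeg D := by
  rw [cpDeg_eq_sum, mul_add, Finset.mul_sum]
  unfold freeBound
  have := Finset.sum_le_sum fun μ hμ => kink_sub_pin_mul_le D m hμ
  linarith

/-- `p^m deg D - p · #supp ≤ W`. [cite: ConnesConsani2017ScalingSite, Lemma 5.19 (iv)] -/
theorem le_freeBound :
    (p : ℝ) ^ m * cpDeg D - p * (suppFinset D).card ≤ freeBound D m := by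
  rw [cpDeg_eq_sum, mul_add, Finset.mul_sum]
  unfold freeBound
  have h1 := Finset.sum_le_sum fun μ hμ => kink_sub_pin_mul_ge D m hμ
  have h2 : ∑ μ ∈ suppFinset D, μ ≤ p * (suppFinset D).card := by
    have := Finset.sum_le_sum fun μ (hμ : μ ∈ suppFinset D) => (mem_suppFinset.1 hμ).2.1.le
    rw [Finset.sum_const, nsmul_eq_mul] at this
    linarith
  rw [Finset.sum_sub_distrib] at h1
  linarith

/-- `S' = Σ_μ (k_μ - n_μ)(p - μ)`. [cite: ConnesConsani2017ScalingSite, Lemma 5.19 (iv)] -/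
def sPrime : ℝ := ∑ μ ∈ suppFinset D, ((kinkWeight D m μ : ℝ) - pinCount D m μ) * (p - μ)

omit hp in
/-- `-p N ≤ S' ≤ p K`. [cite: ConnesConsani2017ScalingSite, Lemma 5.19 (iv)] -/
theorem sPrime_bounds :
    -((p : ℝ) * totalPin D m) ≤ sPrime D m ∧ sPrime D m ≤ p * totalKink D m := by
  unfold sPrime totalPin totalKink
  push_cast
  rw [Finset.mul_sum, Finset.mul_sum, ← Finset.sum_neg_distrib]
  constructor
  · refine Finset.sum_le_sum fun μ hμ => ?_
    have h1 := (mem_suppFinset.1 hμ).1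
    have h2 := (mem_suppFinset.1 hμ).2.1
    have hk : (0 : ℝ) ≤ kinkWeight D m μ := Nat.cast_nonneg _
    have hn : (0 : ℝ) ≤ pinCount D m μ := Nat.cast_nonneg _
    nlinarith
  · refine Finset.sum_le_sum fun μ hμ => ?_
    have h1 := (mem_suppFinset.1 hμ).1
    have h2 := (mem_suppFinset.1 hμ).2.1
    have hk : (0 : ℝ) ≤ kinkWeight D m μ := Nat.cast_nonneg _
    have hn : (0 : ℝ) ≤ pinCount D m μ := Nat.cast_nonneg _
    nlinarith

omit hp in
/-- `S' = pK - pN - Σ (k_μ - n_μ) μ`. [cite: ConnesConsani2017ScalingSite, Lemma 5.19 (iv)] -/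
theorem sPrime_eq : sPrime D m = p * totalKink D m - p * totalPin D m -
    ∑ μ ∈ suppFinset D, ((kinkWeight D m μ : ℝ) - pinCount D m μ) * μ := by
  unfold sPrime totalKink totalPin
  push_cast
  rw [Finset.mul_sum, Finset.mul_sum, ← Finset.sum_sub_distrib, ← Finset.sum_sub_distrib]
  exact Finset.sum_congr rfl fun _ _ => by ring

end WBounds

/-! #### The constants of the lower-bound family -/

section LBConst

variable (D : CpDivisor p) (m : ℕ)

/-- `L - 1`, where `L = ⌊W⌋ - p` is the number of free generators of the family.
[cite: ConnesConsani2017ScalingSite, Lemma 5.19 (iii) (the `N - p + 1` parameters)] -/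
def lDim : ℕ := ⌊freeBound D m⌋₊ - p - 1

/-- `q = ⌈(pL - W - S')/(p-1)⌉`, the shift of the slope at `1`. [cite: ConnesConsani2017ScalingSite, Lemma 5.19 (iii)] -/
def qShift : ℤ :=
  ⌈((p : ℝ) * (lDim D m + 1 : ℕ) - freeBound D m - sPrime D m) / ((p : ℝ) - 1)⌉

/-- `R = q (p-1) + S' = Σ_l (p - z_l)`. [cite: ConnesConsani2017ScalingSite, Lemma 5.19 (iii) (`Σ (p - t_i) = N - pk`)] -/
def rSum : ℝ := (qShift D m : ℝ) * ((p : ℝ) - 1) + sPrime D m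

/-- `a = A - q` generators at `1`. [cite: ConnesConsani2017ScalingSite, Lemma 5.19 (iii)] -/
def aOne : ℕ := ((bigA D m : ℤ) - qShift D m).toNat

/-- `b = M - a - N - L` generators at `p`. [cite: ConnesConsani2017ScalingSite, Lemma 5.19 (iii)] -/
def bTop : ℕ := bigM D m - aOne D m - totalPin D m - (lDim D m + 1)

variable {D m}

omit hp in
/-- `L = ⌊W⌋ - p` as a real number. [cite: ConnesConsani2017ScalingSite, Lemma 5.19 (iii)] -/
theorem lDim_cast (hW : 2 * (p : ℝ) + 4 ≤ freeBound D m) :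
    ((lDim D m + 1 : ℕ) : ℝ) = ⌊freeBound D m⌋₊ - p := by
  have h1 : 2 * p + 4 ≤ ⌊freeBound D m⌋₊ := Nat.le_floor (by push_cast; linarith)
  have h2 : lDim D m + 1 = ⌊freeBound D m⌋₊ - p := by unfold lDim; omega
  rw [h2, Nat.cast_sub (by omega)]

omit hp in
/-- `W - 1 - p ≤ L ≤ W - p`. [cite: ConnesConsani2017ScalingSite, Lemma 5.19 (iii)] -/
theorem lDim_bounds (hW : 2 * (p : ℝ) + 4 ≤ freeBound D m) :
    freeBound D m - 1 - p ≤ ((lDim D m + 1 : ℕ) : ℝ) ∧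
      ((lDim D m + 1 : ℕ) : ℝ) ≤ freeBound D m - p := by
  have hW0 : 0 ≤ freeBound D m := by linarith
  have hfl : (⌊freeBound D m⌋₊ : ℝ) ≤ freeBound D m := Nat.floor_le hW0
  have hfl' : freeBound D m < ⌊freeBound D m⌋₊ + 1 := Nat.lt_floor_add_one _
  rw [lDim_cast hW]
  constructor <;> linarith

/-- The defining inequalities of `q`. [cite: ConnesConsani2017ScalingSite, Lemma 5.19 (iii)] -/
theorem qShift_bounds :
    (p : ℝ) * (lDim D m + 1 : ℕ) - freeBound D m - sPrime D m ≤ (qShift D m : ℝ) * ((p : ℝ) - 1) ∧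
      (qShift D m : ℝ) * ((p : ℝ) - 1) <
        (p : ℝ) * (lDim D m + 1 : ℕ) - freeBound D m - sPrime D m + ((p : ℝ) - 1) := by
  have hp1 : (0 : ℝ) < (p : ℝ) - 1 := by
    have : (2 : ℝ) ≤ p := by exact_mod_cast hp.out.two_le
    linarith
  have hq1 := Int.le_ceil (((p : ℝ) * (lDim D m + 1 : ℕ) - freeBound D m - sPrime D m) / ((p : ℝ) - 1))
  have hq2 := Int.ceil_lt_add_one
    (((p : ℝ) * (lDim D m + 1 : ℕ) - freeBound D m - sPrime D m) / ((p : ℝ) - 1))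
  unfold qShift
  constructor
  · rwa [div_le_iff₀ hp1] at hq1
  · have := (lt_div_iff₀ hp1).1 (show ((qShift D m : ℝ) - 1) <
      ((p : ℝ) * (lDim D m + 1 : ℕ) - freeBound D m - sPrime D m) / ((p : ℝ) - 1) by
        unfold qShift; linarith)
    unfold qShift at this
    linarith

/-- `0 < R < L (p - 1)` and `pL ≤ R + W`. [cite: ConnesConsani2017ScalingSite, Lemma 5.19 (iii)] -/
theorem rSum_bounds (hW : 2 * (p : ℝ) + 4 ≤ freeBound D m) :
    0 < rSum D m ∧ rSum D m < (lDim D m + 1 : ℕ) * ((p : ℝ) - 1) ∧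
      (p : ℝ) * (lDim D m + 1 : ℕ) ≤ rSum D m + freeBound D m := by
  have hp2 : (2 : ℝ) ≤ p := by exact_mod_cast hp.out.two_le
  obtain ⟨hL1, hL2⟩ := lDim_bounds hW
  obtain ⟨hq1, hq2⟩ := qShift_bounds (D := D) (m := m)
  have hR : rSum D m = (qShift D m : ℝ) * ((p : ℝ) - 1) + sPrime D m := rfl
  have hpL : (p : ℝ) * (freeBound D m - 1 - p) ≤ p * (lDim D m + 1 : ℕ) :=
    mul_le_mul_of_nonneg_left hL1 (by linarith)
  have hprod : 0 ≤ ((p : ℝ) - 1) * (freeBound D m - 2 * p - 4) :=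
    mul_nonneg (by linarith) (by linarith)
  refine ⟨?_, ?_, ?_⟩
  · rw [hR]; nlinarith
  · rw [hR]; nlinarith
  · rw [hR]; linarith

/-- `q ≤ A`, so `a = A - q ≥ 0`. [cite: ConnesConsani2017ScalingSite, Lemma 5.19 (iii)] -/
theorem qShift_le_bigA (hW : 2 * (p : ℝ) + 4 ≤ freeBound D m) : qShift D m ≤ bigA D m := by
  have hp2 : (2 : ℝ) ≤ p := by exact_mod_cast hp.out.two_le
  obtain ⟨-, hL2⟩ := lDim_bounds hW
  obtain ⟨-, hq2⟩ := qShift_bounds (D := D) (m := m)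
  obtain ⟨hS1, -⟩ := sPrime_bounds D m
  have hN : (0 : ℝ) ≤ totalPin D m := Nat.cast_nonneg _
  have hK : (0 : ℝ) ≤ totalKink D m := Nat.cast_nonneg _
  have hB : (0 : ℝ) ≤ oneBound D m := Nat.cast_nonneg _
  have hfl' : freeBound D m < ⌊freeBound D m⌋₊ + 1 := Nat.lt_floor_add_one _
  have hpL : (p : ℝ) * (lDim D m + 1 : ℕ) ≤ p * (freeBound D m - p) :=
    mul_le_mul_of_nonneg_left hL2 (by linarith)
  have hpN : 0 ≤ ((p : ℝ) - 2) * totalPin D m := mul_nonneg (by linarith) hN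
  have h1 : (qShift D m : ℝ) * ((p : ℝ) - 1) < (freeBound D m + 2 * totalPin D m + 1) * ((p : ℝ) - 1) := by
    nlinarith
  have h2 : (qShift D m : ℝ) < freeBound D m + 2 * totalPin D m + 1 :=
    lt_of_mul_lt_mul_right h1 (by linarith)
  have hA : (bigA D m : ℝ) = p * totalKink D m + oneBound D m + ⌊freeBound D m⌋₊ +
      2 * totalPin D m + 2 := by
    unfold bigA; push_cast; ring
  have hpK : 0 ≤ (p : ℝ) * totalKink D m := by positivity
  have : (qShift D m : ℝ) ≤ bigA D m := by rw [hA]; linarith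
  exact_mod_cast this

/-- `a = A - q` as an integer. [cite: ConnesConsani2017ScalingSite, Lemma 5.19 (iii)] -/
theorem aOne_cast (hW : 2 * (p : ℝ) + 4 ≤ freeBound D m) :
    ((aOne D m : ℕ) : ℤ) = (bigA D m : ℤ) - qShift D m := by
  have := qShift_le_bigA hW
  unfold aOne
  rw [Int.toNat_of_nonneg (by omega)]

/-- `a + N + L ≤ M`. [cite: ConnesConsani2017ScalingSite, Lemma 5.19 (iii)] -/
theorem aOne_sum_le (hW : 2 * (p : ℝ) + 4 ≤ freeBound D m) :
    aOne D m + totalPin D m + (lDim D m + 1) ≤ bigM D m := by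
  have hp2 : (2 : ℝ) ≤ p := by exact_mod_cast hp.out.two_le
  obtain ⟨hL1, hL2⟩ := lDim_bounds hW
  obtain ⟨hq1, -⟩ := qShift_bounds (D := D) (m := m)
  obtain ⟨-, hS2⟩ := sPrime_bounds D m
  have hK : (0 : ℝ) ≤ totalKink D m := Nat.cast_nonneg _
  have hB : (0 : ℝ) ≤ oneBound D m := Nat.cast_nonneg _
  have hpL : (p : ℝ) * (freeBound D m - 1 - p) ≤ p * (lDim D m + 1 : ℕ) :=
    mul_le_mul_of_nonneg_left hL1 (by linarith)
  have hpp : 0 ≤ (p : ℝ) * (p - 2) := mul_nonneg (by linarith) (by linarith)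
  have hKp : 0 ≤ (totalKink D m : ℝ) * (p - 2) := mul_nonneg hK (by linarith)
  have h1 : (freeBound D m - 3 * p - 2 * totalKink D m) * ((p : ℝ) - 1) ≤
      (qShift D m : ℝ) * ((p : ℝ) - 1) := by nlinarith
  have h2 : freeBound D m - 3 * p - 2 * totalKink D m ≤ qShift D m :=
    le_of_mul_le_mul_right h1 (by linarith)
  have ha : ((aOne D m : ℕ) : ℝ) = bigA D m - qShift D m := by exact_mod_cast aOne_cast hW
  have hM : (bigM D m : ℝ) = bigA D m + 2 * totalKink D m + totalPin D m + oneBound D m + 2 * p := by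
    unfold bigM; push_cast; ring
  have : ((aOne D m : ℕ) : ℝ) + totalPin D m + ((lDim D m + 1 : ℕ) : ℝ) ≤ bigM D m := by
    rw [ha, hM]; linarith
  exact_mod_cast this

end LBConst

/-! #### The index type of the family and its parameters -/

section Family

variable (D : CpDivisor p) (m : ℕ)

/-- The index set of the generators of the family: `a` at `1`, `b` at `p`, `n_μ` at each support
point `μ`, and `L` free ones. [cite: ConnesConsani2017ScalingSite, Lemma 5.19 (iii)] -/
abbrev Idx : Type :=
  (Fin (aOne D m) ⊕ Fin (bTop D m)) ⊕
    ((Σ μ : suppFinset D, Fin (pinCount D m μ)) ⊕ Fin (lDim D m + 1))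

/-- The generator positions as a function on the index set. [cite: ConnesConsani2017ScalingSite, Lemma 5.19 (iii)] -/
def yIdx (z : Fin (lDim D m + 1) → ℝ) : Idx D m → ℝ
  | Sum.inl (Sum.inl _) => 1
  | Sum.inl (Sum.inr _) => p
  | Sum.inr (Sum.inl i) => (i.1 : ℝ)
  | Sum.inr (Sum.inr l) => z l

omit hp in
/-- `|Idx| = a + b + N + L`. [cite: ConnesConsani2017ScalingSite, Lemma 5.19 (iii)] -/
theorem card_Idx : Fintype.card (Idx D m) =
    aOne D m + bTop D m + (totalPin D m + (lDim D m + 1)) := by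
  rw [Fintype.card_sum, Fintype.card_sum, Fintype.card_sum, Fintype.card_fin, Fintype.card_fin,
    Fintype.card_fin, Fintype.card_sigma]
  simp only [Fintype.card_fin]
  rw [totalPin, Finset.sum_coe_sort (suppFinset D) (fun μ => pinCount D m μ)]

variable {D m}

/-- Under `W ≥ 2p+4`, `|Idx| = M`. [cite: ConnesConsani2017ScalingSite, Lemma 5.19 (iii)] -/
theorem card_Idx_eq (hW : 2 * (p : ℝ) + 4 ≤ freeBound D m) :
    Fintype.card (Idx D m) = bigM D m := by
  rw [card_Idx]
  have := aOne_sum_le hW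
  unfold bTop; omega

/-- The identification `Idx ≃ Fin M`. [cite: ConnesConsani2017ScalingSite, Lemma 5.19 (iii)] -/
def idxEquiv (hW : 2 * (p : ℝ) + 4 ≤ freeBound D m) : Idx D m ≃ Fin (bigM D m) :=
  Fintype.equivFinOfCardEq (card_Idx_eq hW)

/-- The generator positions of the family as a vector `Fin M → ℝ`.
[cite: ConnesConsani2017ScalingSite, Lemma 5.19 (iii)] -/
def yLB (hW : 2 * (p : ℝ) + 4 ≤ freeBound D m) (z : Fin (lDim D m + 1) → ℝ) :
    Fin (bigM D m) → ℝ :=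
  fun σ => yIdx D m z ((idxEquiv hW).symm σ)

/-- Sums over the generators of the family split by kind.
[cite: ConnesConsani2017ScalingSite, Lemma 5.19 (iii)] -/
theorem sum_yLB (hW : 2 * (p : ℝ) + 4 ≤ freeBound D m) (z : Fin (lDim D m + 1) → ℝ)
    {β : Type*} [AddCommMonoid β] (g : ℝ → β) :
    ∑ σ, g (yLB hW z σ) = (aOne D m • g 1 + bTop D m • g p) +
      (∑ μ ∈ suppFinset D, pinCount D m μ • g μ + ∑ l, g (z l)) := by
  unfold yLB
  rw [(idxEquiv hW).symm.sum_comp (fun i => g (yIdx D m z i)), Fintype.sum_sum_type,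
    Fintype.sum_sum_type, Fintype.sum_sum_type]
  simp only [yIdx, Finset.sum_const, Finset.card_univ, Fintype.card_fin]
  congr 2
  rw [← Finset.univ_sigma_univ, Finset.sum_sigma]
  simp only [Finset.sum_const, Finset.card_univ, Fintype.card_fin]
  exact Finset.sum_coe_sort (suppFinset D) (fun μ => pinCount D m μ • g μ)

/-- Counting generators satisfying a predicate: the free part plus a part independent of `z`.
[cite: ConnesConsani2017ScalingSite, Lemma 5.19 (iii)] -/
theorem card_yLB (hW : 2 * (p : ℝ) + 4 ≤ freeBound D m) (z : Fin (lDim D m + 1) → ℝ)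
    (P : ℝ → Prop) [DecidablePred P] :
    (Finset.univ.filter fun σ => P (yLB hW z σ)).card =
      (aOne D m • (if P 1 then 1 else 0) + bTop D m • (if P p then 1 else 0)) +
      (∑ μ ∈ suppFinset D, pinCount D m μ • (if P μ then 1 else 0) +
        (Finset.univ.filter fun l => P (z l)).card) := by
  rw [Finset.card_filter, Finset.card_filter, sum_yLB hW z (fun v => if P v then 1 else 0)]

/-- The values of `yLB` lie in `[1, p]` when the free ones do.
[cite: ConnesConsani2017ScalingSite, Lemma 5.19 (iii)] -/
theorem yLB_mem_Icc (hW : 2 * (p : ℝ) + 4 ≤ freeBound D m) {z : Fin (lDim D m + 1) → ℝ}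
    (hz : ∀ l, z l ∈ Icc (1 : ℝ) p) (σ : Fin (bigM D m)) : yLB hW z σ ∈ Icc (1 : ℝ) p := by
  have hp1 : (1 : ℝ) ≤ p := by exact_mod_cast hp.out.one_lt.le
  unfold yLB
  rcases (idxEquiv hW).symm σ with (⟨_⟩ | ⟨_⟩) | (⟨⟨μ, hμ⟩, _⟩ | l)
  · exact ⟨le_rfl, hp1⟩
  · exact ⟨hp1, le_rfl⟩
  · exact ⟨(mem_suppFinset.1 hμ).1.le, (mem_suppFinset.1 hμ).2.1.le⟩
  · exact hz l

/-- **Admissibility of the family**: for free positions in `(1, p)` with `Σ_l (p - z_l) = R`, the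
parameters are admissible (any `t`). [cite: ConnesConsani2017ScalingSite, Lemma 5.19 (iii) ("belongs to `ℰ'_{N,p}`")] -/
theorem paramValid_yLB (hW : 2 * (p : ℝ) + 4 ≤ freeBound D m) {z : Fin (lDim D m + 1) → ℝ}
    (hz : ∀ l, z l ∈ Ioo (1 : ℝ) p) (hsum : ∑ l, ((p : ℝ) - z l) = rSum D m) (t : ℝ) :
    ParamValid D m (bigA D m) t (yLB hW z) := by
  classical
  obtain ⟨hR0, hRL, hRW⟩ := rSum_bounds hW
  have hp1 : (1 : ℝ) < p := by exact_mod_cast hp.out.one_lt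
  have hzc : ∀ l, z l ∈ Icc (1 : ℝ) p := fun l => ⟨(hz l).1.le, (hz l).2.le⟩
  have hy := yLB_mem_Icc hW hzc
  have haR : ((aOne D m : ℕ) : ℝ) = bigA D m - qShift D m := by exact_mod_cast aOne_cast hW
  refine ⟨fun σ => (hy σ).1, fun σ => (hy σ).2, fun μ hμ => ?_, ?_, ?_⟩
  · -- pinned: at least `n_μ` generators sit at `μ`
    have hge : (pinCount D m μ : ℝ) ≤ (Finset.univ.filter fun σ => yLB hW z σ = μ).card := by
      rw [card_yLB hW z (fun v => v = μ)]
      have h1 : pinCount D m μ • (if μ = μ then 1 else 0) ≤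
          ∑ μ' ∈ suppFinset D, pinCount D m μ' • (if μ' = μ then 1 else 0) :=
        Finset.single_le_sum (f := fun μ' => pinCount D m μ' • (if μ' = μ then 1 else 0))
          (fun _ _ => Nat.zero_le _) hμ
      rw [if_pos rfl, smul_eq_mul, mul_one] at h1
      have h2 : ∑ μ' ∈ suppFinset D, pinCount D m μ' • (if μ' = μ then 1 else 0) ≤
          (aOne D m • (if (1 : ℝ) = μ then 1 else 0) + bTop D m • (if (p : ℝ) = μ then 1 else 0)) +
          (∑ μ' ∈ suppFinset D, pinCount D m μ' • (if μ' = μ then 1 else 0) +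
            (Finset.univ.filter fun l => z l = μ).card) :=
        le_trans (Nat.le_add_right _ _) (Nat.le_add_left _ _)
      exact_mod_cast h1.trans h2
    exact le_trans (Nat.le_ceil _) hge
  · -- closure relation `F(p) = F(1)`
    rw [paramFun_one D m _ _ (fun σ => (hy σ).1)]
    unfold paramFun
    rw [Finset.sum_congr rfl fun σ _ => hinge_of_le (hy σ).2,
      Finset.sum_congr rfl fun μ (hμ : μ ∈ suppFinset D) =>
        show (kinkWeight D m μ : ℝ) * hinge μ p = kinkWeight D m μ * (p - μ) by
          rw [hinge_of_le (mem_suppFinset.1 hμ).2.1.le],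
      sum_yLB hW z (fun v => (p : ℝ) - v)]
    simp only [nsmul_eq_mul, sub_self, mul_zero, add_zero]
    rw [hsum]
    have hRdef : rSum D m = (qShift D m : ℝ) * ((p : ℝ) - 1) + sPrime D m := rfl
    have hS : sPrime D m = ∑ μ ∈ suppFinset D, (kinkWeight D m μ : ℝ) * (p - μ) -
        ∑ μ ∈ suppFinset D, (pinCount D m μ : ℝ) * (p - μ) := by
      unfold sPrime
      rw [← Finset.sum_sub_distrib]; exact Finset.sum_congr rfl fun _ _ => by ring
    rw [hRdef, hS, haR]
    ring
  · -- order condition at `1`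
    have h1 : ((Finset.univ.filter fun σ => yLB hW z σ = 1).card : ℝ) = aOne D m := by
      rw [card_yLB hW z (fun v => v = 1)]
      rw [if_pos rfl, if_neg hp1.ne', Finset.sum_eq_zero fun μ hμ => by
        rw [if_neg (mem_suppFinset.1 hμ).1.ne', smul_zero], Finset.filter_false_of_mem
          fun l _ => (hz l).1.ne']
      simp
    have h2 : ((Finset.univ.filter fun σ => yLB hW z σ < p).card : ℝ) =
        aOne D m + totalPin D m + (lDim D m + 1 : ℕ) := by
      rw [card_yLB hW z (fun v => v < p), if_pos hp1, if_neg (lt_irrefl _),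
        Finset.sum_congr rfl fun μ hμ => by rw [if_pos (mem_suppFinset.1 hμ).2.1],
        Finset.filter_true_of_mem fun l _ => (hz l).2]
      simp only [smul_eq_mul, mul_one, mul_zero, add_zero, Finset.card_univ, Fintype.card_fin,
        totalPin]
      push_cast
      ring
    rw [h1, h2]
    have hWdef : freeBound D m = (p : ℝ) ^ m * D.toFun 1 +
        ∑ μ ∈ suppFinset D, ((kinkWeight D m μ : ℝ) - pinCount D m μ) * μ := rfl
    have hS := sPrime_eq D m
    have hRdef : rSum D m = (qShift D m : ℝ) * ((p : ℝ) - 1) + sPrime D m := rfl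
    obtain ⟨hq1, -⟩ := qShift_bounds (D := D) (m := m)
    rw [haR]
    linarith

end Family

/-! #### The base point and the perturbation -/

section Perturb

variable {D : CpDivisor p} {m : ℕ}

/-- The centre `c₀ = p - R/L` of the free positions. [cite: ConnesConsani2017ScalingSite, Lemma 5.19 (iii)] -/
def zCenter (D : CpDivisor p) (m : ℕ) : ℝ := (p : ℝ) - rSum D m / (lDim D m + 1 : ℕ)

/-- The spacing `δ = min(c₀ - 1, p - c₀) / (2L)`. [cite: ConnesConsani2017ScalingSite, Lemma 5.19 (iii)] -/
def zDelta (D : CpDivisor p) (m : ℕ) : ℝ :=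
  min (zCenter D m - 1) ((p : ℝ) - zCenter D m) / (2 * (lDim D m + 1 : ℕ))

/-- The mean of `u`, used as the `t`-coordinate of the family. [cite: ConnesConsani2017ScalingSite, Lemma 5.19 (iii)] -/
def uMean (D : CpDivisor p) (m : ℕ) (u : Fin (lDim D m + 1) → ℝ) : ℝ :=
  (∑ l', u l') / (lDim D m + 1 : ℕ)

/-- The perturbed free positions `z_l(u) = c₀ + δ (2l - (L-1)) + (δ/3)(u_l - ū)`.
[cite: ConnesConsani2017ScalingSite, Lemma 5.19 (iii)] -/
def zPert (D : CpDivisor p) (m : ℕ) (u : Fin (lDim D m + 1) → ℝ) (l : Fin (lDim D m + 1)) : ℝ :=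
  zCenter D m + zDelta D m * (2 * (l : ℝ) - lDim D m) + zDelta D m / 3 * (u l - uMean D m u)

omit hp in
/-- `Σ_{l ≤ n} (2l - n) = 0`. [folklore] -/
private theorem sum_two_mul_sub : ∀ n : ℕ, ∑ l : Fin (n + 1), (2 * (l : ℝ) - n) = 0
  | 0 => by simp
  | n + 1 => by
    rw [Fin.sum_univ_castSucc]
    simp only [Fin.val_castSucc, Fin.val_last, Nat.cast_succ]
    have ih := sum_two_mul_sub n
    have h2 : ∑ l : Fin (n + 1), (2 * (l : ℝ) - (n + 1)) =
        ∑ l : Fin (n + 1), (2 * (l : ℝ) - n) - (n + 1) := by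
      rw [Finset.sum_sub_distrib, Finset.sum_sub_distrib, Finset.sum_const, Finset.sum_const,
        Finset.card_univ, Fintype.card_fin]
      simp only [nsmul_eq_mul]
      push_cast
      ring
    rw [h2, ih]
    ring

omit hp in
/-- `Σ_l (u_l - ū) = 0`. [folklore] -/
private theorem sum_sub_uMean (u : Fin (lDim D m + 1) → ℝ) : ∑ l, (u l - uMean D m u) = 0 := by
  have hL0 : ((lDim D m + 1 : ℕ) : ℝ) ≠ 0 := by positivity
  rw [Finset.sum_sub_distrib, Finset.sum_const, Finset.card_univ, Fintype.card_fin, nsmul_eq_mul,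
    uMean, mul_div_cancel₀ _ hL0, sub_self]

/-- The base-point data: `c₀ ∈ (1, p)`, `δ > 0`, and the margins `2Lδ ≤ c₀ - 1`, `2Lδ ≤ p - c₀`.
[cite: ConnesConsani2017ScalingSite, Lemma 5.19 (iii)] -/
theorem zCenter_bounds (hW : 2 * (p : ℝ) + 4 ≤ freeBound D m) :
    1 < zCenter D m ∧ zCenter D m < p ∧ 0 < zDelta D m ∧
      zDelta D m * (2 * (lDim D m + 1 : ℕ)) ≤ zCenter D m - 1 ∧
      zDelta D m * (2 * (lDim D m + 1 : ℕ)) ≤ p - zCenter D m := by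
  obtain ⟨hR0, hRL, -⟩ := rSum_bounds hW
  have hLpos : (0 : ℝ) < (lDim D m + 1 : ℕ) := by positivity
  have hc1 : 1 < zCenter D m := by
    have : rSum D m / (lDim D m + 1 : ℕ) < p - 1 := by rw [div_lt_iff₀ hLpos]; linarith
    unfold zCenter; linarith
  have hc2 : zCenter D m < p := by
    unfold zCenter
    have : 0 < rSum D m / (lDim D m + 1 : ℕ) := div_pos hR0 hLpos
    linarith
  have hmin : 0 < min (zCenter D m - 1) ((p : ℝ) - zCenter D m) := lt_min (by linarith) (by linarith)
  have h2L : (0 : ℝ) < 2 * (lDim D m + 1 : ℕ) := by positivity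
  refine ⟨hc1, hc2, div_pos hmin h2L, ?_, ?_⟩
  · unfold zDelta; rw [div_mul_cancel₀ _ h2L.ne']; exact min_le_left _ _
  · unfold zDelta; rw [div_mul_cancel₀ _ h2L.ne']; exact min_le_right _ _

omit hp in
/-- On the unit ball (sup norm), `|u_l - ū| ≤ 2`. [cite: ConnesConsani2017ScalingSite, Lemma 5.19 (iii)] -/
theorem abs_sub_uMean_le {u : Fin (lDim D m + 1) → ℝ}
    (hu : u ∈ closedBall (0 : Fin (lDim D m + 1) → ℝ) 1) (l : Fin (lDim D m + 1)) :
    |u l - uMean D m u| ≤ 2 := by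
  rw [mem_closedBall_zero_iff, pi_norm_le_iff_of_nonneg zero_le_one] at hu
  have h1 : ∀ l', |u l'| ≤ 1 := fun l' => by have := hu l'; rwa [Real.norm_eq_abs] at this
  have hn : (0 : ℝ) < (lDim D m + 1 : ℕ) := by positivity
  have hmean : |uMean D m u| ≤ 1 := by
    unfold uMean
    rw [abs_div, abs_of_pos hn, div_le_one hn]
    refine (Finset.abs_sum_le_sum_abs _ _).trans ?_
    have := Finset.sum_le_sum fun l' (_ : l' ∈ Finset.univ) => h1 l'
    simpa using this
  have := abs_sub (u l) (uMean D m u)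
  linarith [h1 l]

/-- Properties of the perturbed positions on the unit ball: strictly increasing, inside `(1,p)`,
with the prescribed sum. [cite: ConnesConsani2017ScalingSite, Lemma 5.19 (iii)] -/
theorem zPert_props (hW : 2 * (p : ℝ) + 4 ≤ freeBound D m) {u : Fin (lDim D m + 1) → ℝ}
    (hu : u ∈ closedBall (0 : Fin (lDim D m + 1) → ℝ) 1) :
    StrictMono (zPert D m u) ∧ (∀ l, zPert D m u l ∈ Ioo (1 : ℝ) p) ∧
      ∑ l, ((p : ℝ) - zPert D m u l) = rSum D m := by
  obtain ⟨hc1, hc2, hδ, hm1, hm2⟩ := zCenter_bounds hW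
  have hpert : ∀ l, |zDelta D m / 3 * (u l - uMean D m u)| ≤ 2 * zDelta D m / 3 := by
    intro l
    rw [abs_mul, abs_of_pos (by positivity : (0 : ℝ) < zDelta D m / 3)]
    calc zDelta D m / 3 * |u l - uMean D m u| ≤ zDelta D m / 3 * 2 :=
          mul_le_mul_of_nonneg_left (abs_sub_uMean_le hu l) (by positivity)
      _ = 2 * zDelta D m / 3 := by ring
  have hLn : ((lDim D m + 1 : ℕ) : ℝ) = lDim D m + 1 := by push_cast; ring
  rw [hLn] at hm1 hm2
  refine ⟨?_, fun l => ?_, ?_⟩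
  · -- strictly increasing
    intro l l' hll
    have hgap : (l : ℝ) + 1 ≤ l' := by exact_mod_cast (Fin.lt_def.1 hll)
    have h1 := (abs_le.1 (hpert l)).1
    have h2 := (abs_le.1 (hpert l')).2
    have h3 := (abs_le.1 (hpert l)).2
    have h4 := (abs_le.1 (hpert l')).1
    show zPert D m u l < zPert D m u l'
    unfold zPert
    have : zDelta D m * (2 * (l : ℝ) - lDim D m) + 2 * zDelta D m ≤
        zDelta D m * (2 * (l' : ℝ) - lDim D m) := by nlinarith
    linarith
  · -- in `(1, p)`
    have h1 := abs_le.1 (hpert l)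
    have hl0 : (0 : ℝ) ≤ l := Nat.cast_nonneg _
    have hl1 : (l : ℝ) ≤ lDim D m := by exact_mod_cast Nat.lt_succ_iff.1 l.2
    have hlo : -(zDelta D m * lDim D m) ≤ zDelta D m * (2 * (l : ℝ) - lDim D m) := by nlinarith
    have hhi : zDelta D m * (2 * (l : ℝ) - lDim D m) ≤ zDelta D m * lDim D m := by nlinarith
    constructor
    · show 1 < zPert D m u l
      unfold zPert
      nlinarith
    · show zPert D m u l < p
      unfold zPert
      nlinarith
  · -- the sum
    have hs0 := sum_sub_uMean u
    have h2 := sum_two_mul_sub (lDim D m)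
    have hL0 : ((lDim D m + 1 : ℕ) : ℝ) ≠ 0 := by positivity
    have e : ∑ l, ((p : ℝ) - zPert D m u l) =
        ∑ l : Fin (lDim D m + 1), (((p : ℝ) - zCenter D m) -
          zDelta D m * (2 * (l : ℝ) - lDim D m) - zDelta D m / 3 * (u l - uMean D m u)) :=
      Finset.sum_congr rfl fun l _ => by unfold zPert; ring
    rw [e, Finset.sum_sub_distrib, Finset.sum_sub_distrib, Finset.sum_const, Finset.card_univ,
      Fintype.card_fin, ← Finset.mul_sum, ← Finset.mul_sum, h2, hs0, mul_zero, mul_zero, sub_zero,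
      sub_zero, nsmul_eq_mul]
    unfold zCenter
    rw [sub_sub_cancel, mul_div_cancel₀ _ hL0]

end Perturb

/-! #### The embedded ball -/

section Ball

variable {D : CpDivisor p} {m : ℕ}

/-- The family as a map `u ↦ Ψ(ū, y(z(u)))` into `C([1,p], ℝ)`. [cite: ConnesConsani2017ScalingSite, Lemma 5.19 (iii) (the map `h`)] -/
def lbMap (hW : 2 * (p : ℝ) + 4 ≤ freeBound D m) (u : Fin (lDim D m + 1) → ℝ) :
    C(Icc (1 : ℝ) p, ℝ) :=
  paramMap D m (bigA D m) (bigM D m) (uMean D m u, yLB hW (zPert D m u))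

omit hp in
/-- `u ↦ ū` is continuous. [folklore] -/
private theorem continuous_uMean : Continuous (uMean D m) :=
  (continuous_finsetSum _ fun l _ => continuous_apply l).div_const _

omit hp in
/-- `u ↦ z_l(u)` is continuous. [folklore] -/
private theorem continuous_zPert (l : Fin (lDim D m + 1)) : Continuous fun u => zPert D m u l := by
  unfold zPert
  exact continuous_const.add (continuous_const.mul ((continuous_apply l).sub continuous_uMean))

/-- The family is continuous. [cite: ConnesConsani2017ScalingSite, Lemma 5.19 (iii) ("The map … is continuous")] -/
theorem continuous_lbMap (hW : 2 * (p : ℝ) + 4 ≤ freeBound D m) : Continuous (lbMap hW) := by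
  refine (continuous_paramMap D m _ _).comp (continuous_uMean.prodMk ?_)
  refine continuous_pi fun σ => ?_
  unfold yLB
  generalize (idxEquiv hW).symm σ = i
  rcases i with (_ | _) | (_ | l)
  · exact continuous_const
  · exact continuous_const
  · exact continuous_const
  · exact continuous_zPert l

/-- The family lies in the level set. [cite: ConnesConsani2017ScalingSite, Lemma 5.19 (iii)] -/
theorem lbMap_mem (hW : 2 * (p : ℝ) + 4 ≤ freeBound D m) {u : Fin (lDim D m + 1) → ℝ}
    (hu : u ∈ closedBall (0 : Fin (lDim D m + 1) → ℝ) 1) : lbMap hW u ∈ levelSet D m := by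
  obtain ⟨-, hIoo, hsum⟩ := zPert_props hW hu
  have hv := paramValid_yLB hW hIoo hsum (uMean D m u)
  exact ⟨hv.toLevel, levelRestrict_toLevel hv⟩

/-- The family is injective on the unit ball. [cite: ConnesConsani2017ScalingSite, Lemma 5.19 (iii) ("The map … is injective")] -/
theorem injOn_lbMap (hW : 2 * (p : ℝ) + 4 ≤ freeBound D m) :
    InjOn (lbMap hW) (closedBall (0 : Fin (lDim D m + 1) → ℝ) 1) := by
  classical
  intro u hu u' hu' heq
  have hp1 : (1 : ℝ) ≤ p := by exact_mod_cast hp.out.one_lt.le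
  obtain ⟨hmono, hIoo, -⟩ := zPert_props hW hu
  obtain ⟨hmono', hIoo', -⟩ := zPert_props hW hu'
  have h : ∀ x ∈ Icc (1 : ℝ) p,
      paramFun D m (bigA D m) (uMean D m u) (yLB hW (zPert D m u)) x =
        paramFun D m (bigA D m) (uMean D m u') (yLB hW (zPert D m u')) x :=
    fun x hx => eqOn_of_paramMap_eq heq hx
  have hy := yLB_mem_Icc hW (fun l => ⟨(hIoo l).1.le, (hIoo l).2.le⟩)
  have hy' := yLB_mem_Icc hW (fun l => ⟨(hIoo' l).1.le, (hIoo' l).2.le⟩)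
  have ht : uMean D m u = uMean D m u' := by
    have := h 1 ⟨le_rfl, hp1⟩
    rwa [paramFun_one D m _ _ (fun σ => (hy σ).1), paramFun_one D m _ _ (fun σ => (hy' σ).1)] at this
  have hz : zPert D m u = zPert D m u' := by
    refine eq_of_card_le_eq hmono.monotone hmono'.monotone (fun l => (hIoo l).1.le)
      (fun l => (hIoo' l).1.le) (fun l => (hIoo l).2.le) (fun l => (hIoo' l).2.le)
      fun x hx1 hx2 => ?_
    have hc := card_le_eq_of_eqOn h hx1 hx2
    rw [card_yLB hW _ (fun v => v ≤ x), card_yLB hW _ (fun v => v ≤ x)] at hc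
    omega
  funext l
  have h1 := congrFun hz l
  unfold zPert at h1
  rw [ht] at h1
  have hδ : zDelta D m / 3 ≠ 0 := by
    have := (zCenter_bounds hW).2.2.1; positivity
  have : zDelta D m / 3 * (u l - u' l) = 0 := by linarith
  rcases mul_eq_zero.1 this with h | h
  · exact absurd h hδ
  · linarith

/-- **The lower bound**: for `W ≥ 2p + 4` the image of `H⁰(D)^{p^m}` in `C([1,p], ℝ)` contains an
embedded closed ball of dimension `L = ⌊W⌋ - p`, hence `dim_top H⁰(D)^{p^m} ≥ ⌊W⌋ - p`
(Lebesgue–Brouwer). [cite: ConnesConsani2017ScalingSite, Lemma 5.19 (iii)–(iv) ("the topological dimension of `X = ℰ_{N,p}` is `N - p`")] -/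
theorem not_hasCoveringDimLE_levelSet (hW : 2 * (p : ℝ) + 4 ≤ freeBound D m) :
    ¬ Literature.Topology.DimensionTheory.HasCoveringDimLE (levelSet D m) (lDim D m) := by
  intro hdim
  have hBc : IsCompact (closedBall (0 : Fin (lDim D m + 1) → ℝ) 1) := isCompact_closedBall _ _
  have hsub : lbMap hW '' closedBall 0 1 ⊆ levelSet D m := by
    rintro _ ⟨u, hu, rfl⟩; exact lbMap_mem hW hu
  have hKc : IsClosed (lbMap hW '' closedBall 0 1) :=
    (hBc.image (continuous_lbMap hW)).isClosed
  have h1 : Literature.Topology.DimensionTheory.HasCoveringDimLE (lbMap hW '' closedBall 0 1) (lDim D m) :=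
    (hasCoveringDimLE_preimage_val_iff hsub).1
      (hdim.subtype_of_isClosed (hKc.preimage continuous_subtype_val))
  haveI : CompactSpace (closedBall (0 : Fin (lDim D m + 1) → ℝ) 1) :=
    isCompact_iff_compactSpace.mp hBc
  have hf : IsClosedEmbedding
      (fun u : closedBall (0 : Fin (lDim D m + 1) → ℝ) 1 => lbMap hW u) :=
    ((continuous_lbMap hW).comp continuous_subtype_val).isClosedEmbedding
      fun u u' h => Subtype.ext (injOn_lbMap hW u.2 u'.2 h)
  have hr : range (fun u : closedBall (0 : Fin (lDim D m + 1) → ℝ) 1 => lbMap hW u) =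
      lbMap hW '' closedBall 0 1 := by
    ext g
    simp only [mem_range, mem_image, Subtype.exists, exists_prop]
  have h2 : Literature.Topology.DimensionTheory.HasCoveringDimLE (closedBall (0 : Fin (lDim D m + 1) → ℝ) 1) (lDim D m) := by
    rw [hf.isInducing.hasCoveringDimLE_iff, hr]; exact h1
  exact not_hasCoveringDimLE_closedBall (E := Fin (lDim D m + 1) → ℝ)
    (Module.finrank_fin_fun ℝ) h2

end Ball

end LowerBound

/-! ### Assembly: Theorem 5.17 -/

section Final

open Literature.Topology.DimensionTheory hiding HasCoveringDimLE coveringDim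

variable {p : ℕ} [hp : Fact p.Prime]

/-- **Finiteness at every level**: `dim_top H⁰(D)^{p^m} ≤ ⌊p^m deg D⌋ + 1`.
[cite: ConnesConsani2017ScalingSite, Thm. 5.17 (i) with Lemma 5.19 (iv)] -/
theorem hasCoveringDimLE_cpH0Level (D : CpDivisor p) (m : ℕ) :
    HasCoveringDimLE (CpH0Level D ((p : ℝ) ^ m)) (dimUB D m) :=
  (hasCoveringDimLE_level_iff D _ _).2 (hasCoveringDimLE_levelSet D m)

/-- `dim_top H⁰(D)^{p^m} < ∞`. [cite: ConnesConsani2017ScalingSite, Thm. 5.17 (i)] -/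
theorem coveringDim_cpH0Level_ne_top (D : CpDivisor p) (m : ℕ) :
    coveringDim (CpH0Level D ((p : ℝ) ^ m)) ≠ ⊤ := by
  rw [coveringDim_eq_general]
  exact coveringDim_ne_top_of ((hasCoveringDimLE_iff_general _ _).1 (hasCoveringDimLE_cpH0Level D m))

/-- The upper bound on the normalised dimensions. [cite: ConnesConsani2017ScalingSite, Thm. 5.17 (i), proof (eq. before "when `n → ∞`")] -/
theorem cpDimSeq_le (D : CpDivisor p) (m : ℕ) : cpDimSeq D m ≤ (dimUB D m : ℝ) / (p : ℝ) ^ m := by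
  have hpm : (0 : ℝ) < (p : ℝ) ^ m := pow_pos (by exact_mod_cast hp.out.pos) m
  unfold cpDimSeq
  rw [coveringDim_eq_general]
  gcongr
  exact_mod_cast toNat_coveringDim_le
    ((hasCoveringDimLE_iff_general _ _).1 (hasCoveringDimLE_cpH0Level D m))

/-- The lower bound on the normalised dimensions. [cite: ConnesConsani2017ScalingSite, Thm. 5.17 (i), proof] -/
theorem le_cpDimSeq (D : CpDivisor p) (m : ℕ) (hW : 2 * (p : ℝ) + 4 ≤ freeBound D m) :
    ((lDim D m + 1 : ℕ) : ℝ) / (p : ℝ) ^ m ≤ cpDimSeq D m := by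
  have hpm : (0 : ℝ) < (p : ℝ) ^ m := pow_pos (by exact_mod_cast hp.out.pos) m
  unfold cpDimSeq
  rw [coveringDim_eq_general]
  gcongr
  refine Nat.cast_le.2 (le_toNat_coveringDim (L := lDim D m + 1) (fun k hk h => ?_)
    ((hasCoveringDimLE_iff_general _ _).1 (hasCoveringDimLE_cpH0Level D m)))
  exact not_hasCoveringDimLE_levelSet hW
    ((hasCoveringDimLE_level_iff D _ _).1 ((hasCoveringDimLE_iff_general _ _).2 (h.mono (by omega))))

omit hp in
/-- `0 ≤ Dim`-sequence. [cite: ConnesConsani2017ScalingSite, §5.4 eq. (47)] -/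
theorem cpDimSeq_nonneg (D : CpDivisor p) (m : ℕ) : 0 ≤ cpDimSeq D m := by
  unfold cpDimSeq; positivity

/-- Negative degree: the level sets are empty, the sequence vanishes.
[cite: ConnesConsani2017ScalingSite, Lemma 5.13 (i)] -/
theorem cpDimSeq_eq_zero_of_cpDeg_neg (D : CpDivisor p) (hD : cpDeg D < 0) (n : ℕ) :
    cpDimSeq D n = 0 := by
  haveI : IsEmpty (CpH0Level D ((p : ℝ) ^ n)) := ⟨fun f =>
    (Set.eq_empty_iff_forall_notMem.1 (cpH0_eq_empty_of_cpDeg_neg hp.out.one_lt hD)) f.1 f.2.1⟩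
  have h0 : Literature.Topology.DimensionTheory.HasCoveringDimLE (CpH0Level D ((p : ℝ) ^ n)) 0 := HasCoveringDimLE.of_subsingleton 0
  unfold cpDimSeq
  rw [coveringDim_eq_general, Nat.le_zero.1 (toNat_coveringDim_le h0)]
  simp

/-- **Theorem 5.17 (i), the limit**: `Dim_ℝ(H⁰(D)) = deg D` for `deg D ≥ 0`.
[cite: ConnesConsani2017ScalingSite, Thm. 5.17 (i)] -/
theorem tendsto_cpDimSeq (D : CpDivisor p) (hD : 0 ≤ cpDeg D) :
    Tendsto (cpDimSeq D) atTop (𝓝 (cpDeg D)) := by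
  have hp1 : (1 : ℝ) < p := by exact_mod_cast hp.out.one_lt
  have hp0 : (0 : ℝ) < p := by linarith
  have hinv : Tendsto (fun n : ℕ => ((p : ℝ) ^ n)⁻¹) atTop (𝓝 0) :=
    tendsto_inv_atTop_zero.comp (tendsto_pow_atTop_atTop_of_one_lt hp1)
  -- upper bound `≤ deg D + p^{-n}`
  have hup : ∀ n, cpDimSeq D n ≤ cpDeg D + ((p : ℝ) ^ n)⁻¹ := by
    intro n
    have hpn : (0 : ℝ) < (p : ℝ) ^ n := pow_pos hp0 n
    refine (cpDimSeq_le D n).trans ?_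
    unfold dimUB
    have hfl : (⌊(p : ℝ) ^ n * cpDeg D⌋₊ : ℝ) ≤ (p : ℝ) ^ n * cpDeg D :=
      Nat.floor_le (mul_nonneg hpn.le hD)
    rw [div_le_iff₀ hpn, add_mul, inv_mul_cancel₀ hpn.ne']
    push_cast
    linarith
  have hlim_up : Tendsto (fun n => cpDeg D + ((p : ℝ) ^ n)⁻¹) atTop (𝓝 (cpDeg D)) := by
    simpa using tendsto_const_nhds.add hinv
  rcases hD.eq_or_lt with hd0 | hdpos
  · -- `deg D = 0`: squeeze between `0` and `p^{-n}`
    refine tendsto_of_tendsto_of_tendsto_of_le_of_le' tendsto_const_nhds hlim_up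
      (Eventually.of_forall fun n => ?_) (Eventually.of_forall hup)
    rw [← hd0]; exact cpDimSeq_nonneg D n
  · -- `deg D > 0`: lower bound `deg D - C p^{-n}` eventually
    set C : ℝ := p * (suppFinset D).card + 1 + p with hC
    have hlim_lo : Tendsto (fun n => cpDeg D - C * ((p : ℝ) ^ n)⁻¹) atTop (𝓝 (cpDeg D)) := by
      simpa using tendsto_const_nhds.sub (hinv.const_mul C)
    have hev : ∀ᶠ n in atTop, 2 * (p : ℝ) + 4 ≤ freeBound D n := by
      have ht : Tendsto (fun n : ℕ => (p : ℝ) ^ n * cpDeg D) atTop atTop :=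
        (tendsto_pow_atTop_atTop_of_one_lt hp1).atTop_mul_const hdpos
      filter_upwards [ht.eventually_ge_atTop (2 * (p : ℝ) + 4 + p * (suppFinset D).card)]
        with n hn
      have := le_freeBound D n
      linarith
    refine tendsto_of_tendsto_of_tendsto_of_le_of_le' hlim_lo hlim_up ?_ (Eventually.of_forall hup)
    filter_upwards [hev] with n hn
    have hpn : (0 : ℝ) < (p : ℝ) ^ n := pow_pos hp0 n
    refine le_trans ?_ (le_cpDimSeq D n hn)
    have h1 := (lDim_bounds hn).1
    have h2 := le_freeBound D n
    rw [le_div_iff₀ hpn, sub_mul, mul_assoc, inv_mul_cancel₀ hpn.ne', mul_one]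
    linarith

end Final

/-- **Connes–Consani 2017, Theorem 5.17 (Riemann–Roch of type II on `C_p`)** — discharge of the
named fact `ConnesConsani2017_thm_5_17`: for every prime `p` and every divisor `D` on `C_p`,
(i) if `deg D ≥ 0` then every level `H⁰(D)^{pⁿ}` has finite covering dimension and
`Dim_ℝ H⁰(D) := lim p⁻ⁿ dim_top H⁰(D)^{pⁿ} = deg D`; (ii) `Dim_ℝ H⁰(D) - Dim_ℝ H⁰(-D) = deg D`.
[cite: ConnesConsani2017ScalingSite, Thm. 5.17] -/
theorem ConnesConsani2017_thm_5_17_holds : ConnesConsani2017_thm_5_17 := by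
  intro p hprime D
  haveI : Fact p.Prime := ⟨hprime⟩
  refine ⟨fun hD => ⟨fun n => coveringDim_cpH0Level_ne_top D n, tendsto_cpDimSeq D hD⟩, ?_⟩
  rcases lt_trichotomy (cpDeg D) 0 with h | h | h
  · refine ⟨0, cpDeg D.neg, ?_, tendsto_cpDimSeq D.neg (by rw [cpDeg_neg]; linarith),
      by rw [cpDeg_neg]; ring⟩
    have : cpDimSeq D = fun _ => 0 := funext (cpDimSeq_eq_zero_of_cpDeg_neg D h)
    rw [this]; exact tendsto_const_nhds
  · refine ⟨cpDeg D, cpDeg D.neg, tendsto_cpDimSeq D h.ge,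
      tendsto_cpDimSeq D.neg (by rw [cpDeg_neg, h, neg_zero]), by rw [cpDeg_neg, h]; ring⟩
  · refine ⟨cpDeg D, 0, tendsto_cpDimSeq D h.le, ?_, by ring⟩
    have : cpDimSeq D.neg = fun _ => 0 :=
      funext (cpDimSeq_eq_zero_of_cpDeg_neg D.neg (by rw [cpDeg_neg]; linarith))
    rw [this]; exact tendsto_const_nhds







end Literature.NumberTheory.ConnesConsani
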